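import Literature.RepresentationTheory.FiniteGroups.KLRGradedCellularBasisBraidProofs
import HarnessLib

/-!
# Towards `KLRGradedCellularBasis_holds`, III: the `ψ`-braid relation (R7) with repeated residues

Topic `Literature/RepresentationTheory/FiniteGroups`; third "Proofs" sibling of
`KLRGradedCellularBasis.lean` (Hu–Mathas 2010, Main Theorem, level one and degenerate), continuing
`KLRGradedCellularBasisBraidProofs.lean` (which constructs Brundan–Kleshchev's `ψ_r`, `p_r(𝐢)`,
`q_r(𝐢)` in `k[S_n]` and proves all relations of BK Theorem 3.2 = the cyclotomic KLR presentation,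
arXiv:0808.2032, except the braid relation (R7) when two of `i_r, i_{r+1}, i_{r+2}` coincide).
Same conventions (D-0026: inline lemmas, no new named facts). Here:

* `bkPhi_mul_bkNilpotent_succ_mul_of_mem_eq`, `bkPhi_mul_bkNilpotent_mul_of_mem_eq` — **the
  twisted exchange rules on `M_𝐢` when `i_r = i_{r+1}`: `φ_r y_{r+1} w = y_r φ_r w + q w`,
  `φ_r y_r w = y_{r+1} φ_r w - q w` with `q = q_r(𝐢) = 1 + y_{r+1} - y_r`** (the `φ`-form of
  Brundan–Kleshchev's Demazure identity (EDDR) `ψ_r f = ({}^{s_r}f) ψ_r + ∂_r(f)`), and the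
  resulting rules for the difference units at positions `(r, t)`, `(r+1, t)` and their inverses
  (`bkPhi_mul_bkDiffUnit_mul_of_mem_eq_left/right`, `bkPhi_mul_bkPinv_mul_of_mem_eq_left/right`);
* `bkTwistK`, `bkTwistC`, `bkTwistC'` — the explicit `∂`-corrections — and
  `bkPhi_mul_bkQ_mul_of_mem_eq_last/first`: **`φ_r q_{(r,t)} w = q_{(r+1,t)} φ_r w + C w`,
  `φ_r q_{(r+1,t)} w = q_{(r,t)} φ_r w - C w`** (and the same with `t` first, correction `C'`),
  by the four quiver cases of `(i_r, i_t)` for the explicit `q` of BK (3.30);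
* `bkPhi_mul_inv_mul_of_opposite` — if `φ_r T w = q₂ φ_r w + C w` and `φ_r q₂ w = T φ_r w - C w`
  then `φ_r (T^{-1} q₂^{-1}) w = (T^{-1} q₂^{-1}) φ_r w` ("`∂_r f = 0` for `s_r`-invariant `f`",
  the key step of Case 2 of BK's proof of (R7)), and its instances
  `bkPhi_mul_ringInverse_bkQ_pair_mul_of_mem_eq(')`;
* `bkPsi_braid_of_eq_ne`, `bkPsi_braid_of_ne_eq` — **(R7) of BK Thm 3.2, Cases 2 and 3:
  `ψ_rψ_{r+1}ψ_r e(𝐢) = ψ_{r+1}ψ_rψ_{r+1} e(𝐢)` for `i_r = i_{r+1} ≠ i_{r+2}` and for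
  `i_r ≠ i_{r+1} = i_{r+2}`;**
* `yAlg` — the double commutant `Y''` of `{y_1, …, y_n}`, a commutative (`IsMulCommutative`)
  subalgebra containing the `y_r`, the `p`'s, `q`'s, `K`, `C`, `C'` and the inverses of its units,
  in which the scalar identities are settled by `linear_combination`
  (`bkCase4_scalar`); `bkPhi_mul_ringInverse_mul_of_rule` (`∂` of an inverse),
  `bkPhi_mul_bkTwistK/C/C'_mul_of_mem_gen` (plain exchange of the corrections),
  `bkPsi_triple_case4_lhs/rhs` (the two sides of BK's Case 4 in element form) and
  `bkPsi_braid_of_eq_of_ne` — **(R7) of BK Thm 3.2, Case 4: for `i_r = i_{r+2} ≠ i_{r+1}`,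
  `ψ_rψ_{r+1}ψ_r e(𝐢) = ψ_{r+1}ψ_rψ_{r+1} e(𝐢) + c e(𝐢)` with `c = 1, -1, y_r - 2y_{r+1} + y_{r+2}, 0`
  according as `i_r → i_{r+1}`, `i_r ← i_{r+1}`, `i_r ⇄ i_{r+1}`, unrelated.**

* `bkPsi_mul_of_mem_eq` (**`ψ_r = q̄_r^{-1}(s_r - 1)` on an all-equal block** — in the polynomial
  picture minus a Demazure operator), `of_swap_mul_bkQ_rules`, `of_swap_mul_moves`
  (the degenerate-affine-Hecke moves `s_r y_r = y_{r+1}s_r - 1` applied to the six linear units),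
  `bkCase5_scalars`, `bkPsi_triple_case5_lhs/rhs` and `bkPsi_braid_of_eq_eq` — **(R7), Case 5
  (`i_r = i_{r+1} = i_{r+2}`, "left as an exercise" in BK): `ψ_rψ_{r+1}ψ_r e(𝐢) = ψ_{r+1}ψ_rψ_{r+1} e(𝐢)`**,
  both sides being `-(q̄_1q̄_2Ē)^{-1} Σ_{σ∈S_3} sgn(σ) σ e(𝐢)`;
* `bkPsi_braid` — **(R7) in all cases.** With the two earlier siblings this completes the proof that
  all defining relations of Brundan–Kleshchev's cyclotomic KLR presentation (Thm 3.2 = Main Theorem of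
  arXiv:0808.2032 at level one, degenerate case; Hu–Mathas Thm 24) hold for the elements `e(𝐢)`,
  `y_r`, `ψ_r` of `k[S_n]`.

Still missing towards `KLRGradedCellularBasis_holds`: BK Thm 3.3 (the inverse map), §3.5 (the graded
isomorphism, which needs the abstract graded algebra `R^{Λ_0}_n`), and Hu–Mathas §3.3–§5 (see the
first sibling's docstring).

## References

* J. Hu, A. Mathas, *Graded cellular bases for the cyclotomic Khovanov–Lauda–Rouquier algebras of
  type A*, Adv. Math. 225 (2010), arXiv:0907.2985, Main Theorem, Thm 24. [HuMathas2010]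
* J. Brundan, A. Kleshchev, *Blocks of cyclotomic Hecke algebras and Khovanov–Lauda algebras*,
  Invent. Math. 178 (2009), arXiv:0808.2032, Thm 3.2 and its proof (pp. 9–10) — followed here;
  cited through [HuMathas2010, Thm 24].
-/

noncomputable section

open scoped BigOperators

namespace Literature.RepresentationTheory.FiniteGroups

section BKPartial

open Equiv

variable (k : Type*) [Field k] [DecidableEq k] {n : ℕ}

/-- **`φ_r y_{r+1} w = y_r φ_r w + q_r(𝐢) w` on `M_𝐢` for `i_r = i_{r+1}`** (`q_r(𝐢) = 1 + y_{r+1} -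
y_r`; from (EI3), equal case). [folklore] -/
theorem bkPhi_mul_bkNilpotent_succ_mul_of_mem_eq {r r' : Fin n} (h : (r' : ℕ) = r + 1)
    {χ : Fin n → k} (hc : χ r = χ r') {w : MonoidAlgebra k (Perm (Fin n))}
    (hw : w ∈ jointEigenspace k χ) :
    bkPhi k r r' * (bkNilpotent k r' * w) =
      bkNilpotent k r * (bkPhi k r r' * w) + bkQ k r r' χ * w := by
  have hfix : χ ∘ swap r r' = χ := by
    funext x
    simp only [Function.comp_apply]
    by_cases h1 : x = r
    · subst h1; rw [swap_apply_left, hc]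
    by_cases h2 : x = r'
    · subst h2; rw [swap_apply_right, hc]
    rw [swap_apply_of_ne_of_ne h1 h2]
  have hq : bkQ k r r' χ = 1 + (bkNilpotent k r' - bkNilpotent k r) := by rw [bkQ, if_pos hc]
  -- the `e(𝐢)`-version
  have he : bkPhi k r r' * (bkNilpotent k r' * klrIdempotent k χ) =
      bkNilpotent k r * (bkPhi k r r' * klrIdempotent k χ) + bkQ k r r' χ * klrIdempotent k χ := by
    have hL := bkPhi_mul_jucysMurphy_succ_mul_klrIdempotent k h χ
    rw [if_pos hc] at hL
    have hy' : bkNilpotent k r' =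
        jucysMurphy k r' - ∑ ψ ∈ residueSeqs k n, ψ r' • klrIdempotent k ψ :=
      eq_sub_of_add_eq (jucysMurphy_eq_bkNilpotent_add k r').symm
    have hy : bkNilpotent k r =
        jucysMurphy k r - ∑ ψ ∈ residueSeqs k n, ψ r • klrIdempotent k ψ :=
      eq_sub_of_add_eq (jucysMurphy_eq_bkNilpotent_add k r).symm
    have hD' : (∑ ψ ∈ residueSeqs k n, ψ r' • klrIdempotent k ψ) * klrIdempotent k χ =
        χ r' • klrIdempotent k χ := sum_smul_klrIdempotent_mul_of_mem k r' (klrIdempotent_mem k χ)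
    have hφe : bkPhi k r r' * klrIdempotent k χ ∈ jointEigenspace k χ := by
      have := bkPhi_mul_mem k h (klrIdempotent_mem k χ)
      rwa [hfix] at this
    have hD : (∑ ψ ∈ residueSeqs k n, ψ r • klrIdempotent k ψ) * (bkPhi k r r' * klrIdempotent k χ) =
        χ r' • (bkPhi k r r' * klrIdempotent k χ) := by
      rw [sum_smul_klrIdempotent_mul_of_mem k r hφe, hc]
    have hx : (jucysMurphy k r - jucysMurphy k r') * klrIdempotent k χ =
        (bkNilpotent k r - bkNilpotent k r') * klrIdempotent k χ := by
      rw [jucysMurphy_sub_mul_of_mem k r r' (klrIdempotent_mem k χ), hc, sub_self, bkDiffUnit,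
        map_zero, zero_add]
    rw [hy', sub_mul, mul_sub, hD', mul_smul_comm, ← mul_assoc, hL, hy, hq,
      sub_mul (jucysMurphy k r * bkPhi k r r' + 1) (jucysMurphy k r - jucysMurphy k r')
        (klrIdempotent k χ),
      add_mul (jucysMurphy k r * bkPhi k r r') 1 (klrIdempotent k χ), one_mul, hx,
      sub_mul (jucysMurphy k r) _ (bkPhi k r r' * klrIdempotent k χ), hD,
      mul_assoc (jucysMurphy k r) (bkPhi k r r') (klrIdempotent k χ),
      sub_mul (bkNilpotent k r) (bkNilpotent k r') (klrIdempotent k χ),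
      add_mul 1 (bkNilpotent k r' - bkNilpotent k r) (klrIdempotent k χ), one_mul,
      sub_mul (bkNilpotent k r') (bkNilpotent k r) (klrIdempotent k χ)]
    abel
  rw [← klrIdempotent_mul_of_mem k hw, ← mul_assoc (bkNilpotent k r'), ← mul_assoc (bkPhi k r r'),
    he, add_mul, mul_assoc, mul_assoc, mul_assoc]


/-- **`φ_r y_r w = y_{r+1} φ_r w - q_r(𝐢) w` on `M_𝐢` for `i_r = i_{r+1}`** (from (EI4), equal case).
[folklore] -/
theorem bkPhi_mul_bkNilpotent_mul_of_mem_eq {r r' : Fin n} (h : (r' : ℕ) = r + 1)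
    {χ : Fin n → k} (hc : χ r = χ r') {w : MonoidAlgebra k (Perm (Fin n))}
    (hw : w ∈ jointEigenspace k χ) :
    bkPhi k r r' * (bkNilpotent k r * w) =
      bkNilpotent k r' * (bkPhi k r r' * w) - bkQ k r r' χ * w := by
  have hfix : χ ∘ swap r r' = χ := by
    funext x
    simp only [Function.comp_apply]
    by_cases h1 : x = r
    · subst h1; rw [swap_apply_left, hc]
    by_cases h2 : x = r'
    · subst h2; rw [swap_apply_right, hc]
    rw [swap_apply_of_ne_of_ne h1 h2]
  have hq : bkQ k r r' χ = 1 + (bkNilpotent k r' - bkNilpotent k r) := by rw [bkQ, if_pos hc]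
  have he : bkPhi k r r' * (bkNilpotent k r * klrIdempotent k χ) =
      bkNilpotent k r' * (bkPhi k r r' * klrIdempotent k χ) - bkQ k r r' χ * klrIdempotent k χ := by
    have hL := jucysMurphy_succ_mul_bkPhi_mul_klrIdempotent k h χ
    rw [if_pos hc] at hL
    have hy' : bkNilpotent k r' =
        jucysMurphy k r' - ∑ ψ ∈ residueSeqs k n, ψ r' • klrIdempotent k ψ :=
      eq_sub_of_add_eq (jucysMurphy_eq_bkNilpotent_add k r').symm
    have hy : bkNilpotent k r =
        jucysMurphy k r - ∑ ψ ∈ residueSeqs k n, ψ r • klrIdempotent k ψ :=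
      eq_sub_of_add_eq (jucysMurphy_eq_bkNilpotent_add k r).symm
    have hD : (∑ ψ ∈ residueSeqs k n, ψ r • klrIdempotent k ψ) * klrIdempotent k χ =
        χ r • klrIdempotent k χ := sum_smul_klrIdempotent_mul_of_mem k r (klrIdempotent_mem k χ)
    have hφe : bkPhi k r r' * klrIdempotent k χ ∈ jointEigenspace k χ := by
      have := bkPhi_mul_mem k h (klrIdempotent_mem k χ)
      rwa [hfix] at this
    have hD' : (∑ ψ ∈ residueSeqs k n, ψ r' • klrIdempotent k ψ) * (bkPhi k r r' * klrIdempotent k χ) =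
        χ r • (bkPhi k r r' * klrIdempotent k χ) := by
      rw [sum_smul_klrIdempotent_mul_of_mem k r' hφe, hc]
    have hx : (jucysMurphy k r - jucysMurphy k r') * klrIdempotent k χ =
        (bkNilpotent k r - bkNilpotent k r') * klrIdempotent k χ := by
      rw [jucysMurphy_sub_mul_of_mem k r r' (klrIdempotent_mem k χ), hc, sub_self, bkDiffUnit,
        map_zero, zero_add]
    -- `y' (φ e) = L' φ e - D' φ e = (φ L + 1 - (L - L')) e - c • φ e`
    rw [mul_assoc] at hL
    rw [hy, sub_mul, mul_sub, hD, mul_smul_comm, ← mul_assoc, hy', sub_mul, hD', hq, hL,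
      sub_mul (bkPhi k r r' * jucysMurphy k r + 1) (jucysMurphy k r - jucysMurphy k r')
        (klrIdempotent k χ),
      add_mul (bkPhi k r r' * jucysMurphy k r) 1 (klrIdempotent k χ), one_mul, hx,
      sub_mul (bkNilpotent k r) (bkNilpotent k r') (klrIdempotent k χ),
      add_mul 1 (bkNilpotent k r' - bkNilpotent k r) (klrIdempotent k χ), one_mul,
      sub_mul (bkNilpotent k r') (bkNilpotent k r) (klrIdempotent k χ)]
    abel
  rw [← klrIdempotent_mul_of_mem k hw, ← mul_assoc (bkNilpotent k r), ← mul_assoc (bkPhi k r r'),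
    he, sub_mul, mul_assoc, mul_assoc, mul_assoc]

/-- `φ_r (c + y_r - y_t) w = (c + y_{r+1} - y_t) φ_r w - q w` on `M_𝐢`, `i_r = i_{r+1}`, `t ∉ {r, r+1}`.
[folklore] -/
theorem bkPhi_mul_bkDiffUnit_mul_of_mem_eq_left {r r' t : Fin n} (h : (r' : ℕ) = r + 1)
    (htr : t ≠ r) (htr' : t ≠ r') {χ : Fin n → k} (hc : χ r = χ r')
    {w : MonoidAlgebra k (Perm (Fin n))} (hw : w ∈ jointEigenspace k χ) (c : k) :
    bkPhi k r r' * (bkDiffUnit k r t c * w) =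
      bkDiffUnit k r' t c * (bkPhi k r r' * w) - bkQ k r r' χ * w := by
  rw [bkDiffUnit, bkDiffUnit, add_mul (algebraMap k _ c) _ w, sub_mul (bkNilpotent k r) _ w,
    mul_add (bkPhi k r r'), mul_sub (bkPhi k r r'), ← mul_assoc (bkPhi k r r') (algebraMap k _ c) w,
    ← (Algebra.commute_algebraMap_left c (bkPhi k r r')).eq, mul_assoc (algebraMap k _ c),
    bkPhi_mul_bkNilpotent_mul_of_mem_eq k h hc hw, ← mul_assoc (bkPhi k r r') (bkNilpotent k t) w,
    bkPhi_mul_bkNilpotent_of_ne k h htr htr', mul_assoc (bkNilpotent k t),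
    add_mul (algebraMap k _ c) _ (bkPhi k r r' * w), sub_mul (bkNilpotent k r') _ (bkPhi k r r' * w)]
  abel

/-- `φ_r (c + y_{r+1} - y_t) w = (c + y_r - y_t) φ_r w + q w` on `M_𝐢`, `i_r = i_{r+1}`, `t ∉ {r, r+1}`.
[folklore] -/
theorem bkPhi_mul_bkDiffUnit_mul_of_mem_eq_right {r r' t : Fin n} (h : (r' : ℕ) = r + 1)
    (htr : t ≠ r) (htr' : t ≠ r') {χ : Fin n → k} (hc : χ r = χ r')
    {w : MonoidAlgebra k (Perm (Fin n))} (hw : w ∈ jointEigenspace k χ) (c : k) :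
    bkPhi k r r' * (bkDiffUnit k r' t c * w) =
      bkDiffUnit k r t c * (bkPhi k r r' * w) + bkQ k r r' χ * w := by
  rw [bkDiffUnit, bkDiffUnit, add_mul (algebraMap k _ c) _ w, sub_mul (bkNilpotent k r') _ w,
    mul_add (bkPhi k r r'), mul_sub (bkPhi k r r'), ← mul_assoc (bkPhi k r r') (algebraMap k _ c) w,
    ← (Algebra.commute_algebraMap_left c (bkPhi k r r')).eq, mul_assoc (algebraMap k _ c),
    bkPhi_mul_bkNilpotent_succ_mul_of_mem_eq k h hc hw, ← mul_assoc (bkPhi k r r') (bkNilpotent k t) w,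
    bkPhi_mul_bkNilpotent_of_ne k h htr htr', mul_assoc (bkNilpotent k t),
    add_mul (algebraMap k _ c) _ (bkPhi k r r' * w), sub_mul (bkNilpotent k r) _ (bkPhi k r r' * w)]
  abel

/-- Left multiplication by a difference unit or its inverse preserves `M_𝐢`. [folklore] -/
theorem bkDiffUnit_mul_mem (a b : Fin n) (c : k) {χ : Fin n → k} {w : MonoidAlgebra k (Perm (Fin n))}
    (hw : w ∈ jointEigenspace k χ) : bkDiffUnit k a b c * w ∈ jointEigenspace k χ :=
  mul_left_mem_jointEigenspace_of_comm k (fun t => (commute_jucysMurphy_bkDiffUnit k t a b c).eq) hw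

/-- … and for the inverse. [folklore] -/
theorem ringInverse_bkDiffUnit_mul_mem (a b : Fin n) {c : k} (hc : c ≠ 0) {χ : Fin n → k}
    {w : MonoidAlgebra k (Perm (Fin n))} (hw : w ∈ jointEigenspace k χ) :
    Ring.inverse (bkDiffUnit k a b c) * w ∈ jointEigenspace k χ :=
  mul_left_mem_jointEigenspace_of_comm k (fun t => (commute_ringInverse_of_commute
    (commute_jucysMurphy_bkDiffUnit k t a b c) (isUnit_bkDiffUnit k a b hc)).eq) hw

/-- **`φ_r P w = P₂ φ_r w + P₂ q P w` on `M_𝐢` (`i_r = i_{r+1}`)** for `P = (c + y_r - y_t)^{-1}`,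
`P₂ = (c + y_{r+1} - y_t)^{-1}`, `c ≠ 0` — the twisted exchange of the inverse difference unit
(`∂_r` of `P`). [folklore] -/
theorem bkPhi_mul_bkPinv_mul_of_mem_eq_left {r r' t : Fin n} (h : (r' : ℕ) = r + 1)
    (htr : t ≠ r) (htr' : t ≠ r') {χ : Fin n → k} (hc : χ r = χ r')
    {w : MonoidAlgebra k (Perm (Fin n))} (hw : w ∈ jointEigenspace k χ) {c : k} (hc0 : c ≠ 0) :
    bkPhi k r r' * (Ring.inverse (bkDiffUnit k r t c) * w) =
      Ring.inverse (bkDiffUnit k r' t c) * (bkPhi k r r' * w) +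
        Ring.inverse (bkDiffUnit k r' t c) * (bkQ k r r' χ * (Ring.inverse (bkDiffUnit k r t c) * w)) := by
  have hu := isUnit_bkDiffUnit k r t hc0
  have hu' := isUnit_bkDiffUnit k r' t hc0
  have hw₁ := ringInverse_bkDiffUnit_mul_mem k r t hc0 hw
  have key := bkPhi_mul_bkDiffUnit_mul_of_mem_eq_left k h htr htr' hc hw₁ c
  rw [← mul_assoc (bkDiffUnit k r t c), Ring.mul_inverse_cancel _ hu, one_mul] at key
  -- `φ w = D₂ φ(P w) - q P w` ⇒ `φ (P w) = P₂ (φ w + q P w)`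
  have e : bkDiffUnit k r' t c * (bkPhi k r r' * (Ring.inverse (bkDiffUnit k r t c) * w)) =
      bkPhi k r r' * w + bkQ k r r' χ * (Ring.inverse (bkDiffUnit k r t c) * w) := by
    rw [key]; abel
  calc bkPhi k r r' * (Ring.inverse (bkDiffUnit k r t c) * w)
      = Ring.inverse (bkDiffUnit k r' t c) *
          (bkDiffUnit k r' t c * (bkPhi k r r' * (Ring.inverse (bkDiffUnit k r t c) * w))) := by
        rw [← mul_assoc (Ring.inverse (bkDiffUnit k r' t c)) (bkDiffUnit k r' t c),
          Ring.inverse_mul_cancel _ hu', one_mul]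
    _ = _ := by rw [e, mul_add]

/-- **`φ_r P₂ w = P φ_r w - P q P₂ w` on `M_𝐢` (`i_r = i_{r+1}`)**, same notation. [folklore] -/
theorem bkPhi_mul_bkPinv_mul_of_mem_eq_right {r r' t : Fin n} (h : (r' : ℕ) = r + 1)
    (htr : t ≠ r) (htr' : t ≠ r') {χ : Fin n → k} (hc : χ r = χ r')
    {w : MonoidAlgebra k (Perm (Fin n))} (hw : w ∈ jointEigenspace k χ) {c : k} (hc0 : c ≠ 0) :
    bkPhi k r r' * (Ring.inverse (bkDiffUnit k r' t c) * w) =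
      Ring.inverse (bkDiffUnit k r t c) * (bkPhi k r r' * w) -
        Ring.inverse (bkDiffUnit k r t c) * (bkQ k r r' χ * (Ring.inverse (bkDiffUnit k r' t c) * w)) := by
  have hu := isUnit_bkDiffUnit k r' t hc0
  have hu' := isUnit_bkDiffUnit k r t hc0
  have hw₁ := ringInverse_bkDiffUnit_mul_mem k r' t hc0 hw
  have key := bkPhi_mul_bkDiffUnit_mul_of_mem_eq_right k h htr htr' hc hw₁ c
  rw [← mul_assoc (bkDiffUnit k r' t c), Ring.mul_inverse_cancel _ hu, one_mul] at key
  have e : bkDiffUnit k r t c * (bkPhi k r r' * (Ring.inverse (bkDiffUnit k r' t c) * w)) =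
      bkPhi k r r' * w - bkQ k r r' χ * (Ring.inverse (bkDiffUnit k r' t c) * w) := by
    rw [key]; abel
  calc bkPhi k r r' * (Ring.inverse (bkDiffUnit k r' t c) * w)
      = Ring.inverse (bkDiffUnit k r t c) *
          (bkDiffUnit k r t c * (bkPhi k r r' * (Ring.inverse (bkDiffUnit k r' t c) * w))) := by
        rw [← mul_assoc (Ring.inverse (bkDiffUnit k r t c)) (bkDiffUnit k r t c),
          Ring.inverse_mul_cancel _ hu', one_mul]
    _ = _ := by rw [e, mul_sub]

/-- **"`∂_r f = 0` for `s_r`-invariant `f`"** in element form: if `φ T w = q₂ φ w + C w` and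
`φ q₂ w = T φ w - C w` on `M_𝐢`, with `T, q₂` units and `q₂ C = C q₂`, then
`φ (T^{-1} q₂^{-1} w) = T^{-1} q₂^{-1} φ w` on `M_𝐢` (the key step in Case 2 of Brundan–Kleshchev's
proof of (R7)). [folklore] -/
theorem bkPhi_mul_inv_mul_of_opposite {r r' : Fin n} {χ : Fin n → k}
    {T q₂ C : MonoidAlgebra k (Perm (Fin n))}
    (hT : ∀ w ∈ jointEigenspace k χ, bkPhi k r r' * (T * w) = q₂ * (bkPhi k r r' * w) + C * w)
    (hq₂ : ∀ w ∈ jointEigenspace k χ, bkPhi k r r' * (q₂ * w) = T * (bkPhi k r r' * w) - C * w)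
    (huT : IsUnit T) (huq : IsUnit q₂) (hTq : T * q₂ = q₂ * T) (hCq : q₂ * C = C * q₂)
    (hTM : ∀ w ∈ jointEigenspace k χ, Ring.inverse T * w ∈ jointEigenspace k χ)
    (hqM : ∀ w ∈ jointEigenspace k χ, Ring.inverse q₂ * w ∈ jointEigenspace k χ)
    (hq₂M : ∀ w ∈ jointEigenspace k χ, q₂ * w ∈ jointEigenspace k χ)
    {w : MonoidAlgebra k (Perm (Fin n))} (hw : w ∈ jointEigenspace k χ) :
    bkPhi k r r' * (Ring.inverse T * (Ring.inverse q₂ * w)) =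
      Ring.inverse T * (Ring.inverse q₂ * (bkPhi k r r' * w)) := by
  have hFM : Ring.inverse T * (Ring.inverse q₂ * w) ∈ jointEigenspace k χ := hTM _ (hqM _ hw)
  -- `w = T (q₂ F)` for `F = T⁻¹ q₂⁻¹ w`, so `φ w = q₂ T φ F`
  have h1 : w = T * (q₂ * (Ring.inverse T * (Ring.inverse q₂ * w))) := by
    rw [← mul_assoc T q₂, hTq, mul_assoc q₂ T, ← mul_assoc T (Ring.inverse T),
      Ring.mul_inverse_cancel _ huT, one_mul, ← mul_assoc q₂ (Ring.inverse q₂),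
      Ring.mul_inverse_cancel _ huq, one_mul]
  have h2 : bkPhi k r r' * w =
      q₂ * (T * (bkPhi k r r' * (Ring.inverse T * (Ring.inverse q₂ * w)))) := by
    conv_lhs => rw [h1]
    rw [hT _ (hq₂M _ hFM), hq₂ _ hFM, mul_sub, ← mul_assoc q₂ C, hCq, mul_assoc C q₂]
    abel
  rw [h2, ← mul_assoc (Ring.inverse q₂) q₂, Ring.inverse_mul_cancel _ huq, one_mul,
    ← mul_assoc (Ring.inverse T) T, Ring.inverse_mul_cancel _ huT, one_mul]


/-- `y_s` commutes with every difference unit. [folklore] -/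
theorem commute_bkNilpotent_bkDiffUnit (s a b : Fin n) (c : k) :
    Commute (bkNilpotent k s) (bkDiffUnit k a b c) :=
  Commute.add_right (Algebra.commute_algebraMap_right c _)
    ((commute_bkNilpotent k s a).sub_right (commute_bkNilpotent k s b))

/-- `p_{(t,r)}(𝐢) = -p_{(r,t)}(𝐢)` for `i_r ≠ i_t`. [folklore] -/
theorem bkP_swap {r t : Fin n} {χ : Fin n → k} (hk : χ r ≠ χ t) :
    bkP k t r χ = -Ring.inverse (bkDiffUnit k r t (χ r - χ t)) := by
  rw [bkP, if_neg (Ne.symm hk), bkDiffUnit_swap, ringInverse_neg (isUnit_bkDiffUnit k r t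
    (c := -(χ t - χ r)) (by rw [neg_sub]; exact sub_ne_zero.2 hk)), neg_sub]

/-- The basic `∂`-coefficient `K = P₂ · q_r(𝐢) · P` for `φ_r` on `M_𝐢` (`i_r = i_{r+1}`), where
`P = (i_r - i_t + y_r - y_t)^{-1}`, `P₂ = (i_r - i_t + y_{r+1} - y_t)^{-1}`:
`φ_r P w = P₂ φ_r w + K w`, `φ_r P₂ w = P φ_r w - K w`. [folklore] -/
def bkTwistK (r r' t : Fin n) (χ : Fin n → k) : MonoidAlgebra k (Perm (Fin n)) :=
  Ring.inverse (bkDiffUnit k r' t (χ r - χ t)) * bkQ k r r' χ *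
    Ring.inverse (bkDiffUnit k r t (χ r - χ t))

/-- The `∂`-correction of `q_{(r,t)}(𝐢)` through `φ_r` on `M_𝐢` (`i_r = i_{r+1} ≠ i_t`), by quiver
case of `(i_r, i_t)`: `φ_r q_{(r,t)} w = q_{(r+1,t)} φ_r w + C w` and
`φ_r q_{(r+1,t)} w = q_{(r,t)} φ_r w - C w`. [folklore] -/
def bkTwistC (r r' t : Fin n) (χ : Fin n → k) : MonoidAlgebra k (Perm (Fin n)) :=
  if χ t = χ r + 1 then
    (if χ r = χ t + 1 then -bkTwistK k r r' t χ
     else Ring.inverse (bkDiffUnit k r' t (χ r - χ t)) * bkTwistK k r r' t χ +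
       bkTwistK k r r' t χ * Ring.inverse (bkDiffUnit k r t (χ r - χ t)) - bkTwistK k r r' t χ)
  else (if χ r = χ t + 1 then 0 else -bkTwistK k r r' t χ)

/-- The `∂`-correction of `q_{(t,r)}(𝐢)` through `φ_r` on `M_𝐢` (`i_r = i_{r+1} ≠ i_t`):
`φ_r q_{(t,r)} w = q_{(t,r+1)} φ_r w + C' w`, `φ_r q_{(t,r+1)} w = q_{(t,r)} φ_r w - C' w`. [folklore] -/
def bkTwistC' (r r' t : Fin n) (χ : Fin n → k) : MonoidAlgebra k (Perm (Fin n)) :=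
  if χ t = χ r + 1 then (if χ r = χ t + 1 then bkTwistK k r r' t χ else 0)
  else (if χ r = χ t + 1 then
    Ring.inverse (bkDiffUnit k r' t (χ r - χ t)) * bkTwistK k r r' t χ +
      bkTwistK k r r' t χ * Ring.inverse (bkDiffUnit k r t (χ r - χ t)) + bkTwistK k r r' t χ
    else bkTwistK k r r' t χ)

/-- `K` commutes with every `y_s`. [folklore] -/
theorem commute_bkTwistK_bkNilpotent {r r' t : Fin n} {χ : Fin n → k} (hk : χ r ≠ χ t) (s : Fin n) :
    Commute (bkTwistK k r r' t χ) (bkNilpotent k s) := by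
  have hc0 : χ r - χ t ≠ 0 := sub_ne_zero.2 hk
  have hzP : Commute (Ring.inverse (bkDiffUnit k r t (χ r - χ t))) (bkNilpotent k s) :=
    (commute_ringInverse_of_commute (commute_bkNilpotent_bkDiffUnit k s r t _)
      (isUnit_bkDiffUnit k r t hc0)).symm
  have hzP₂ : Commute (Ring.inverse (bkDiffUnit k r' t (χ r - χ t))) (bkNilpotent k s) :=
    (commute_ringInverse_of_commute (commute_bkNilpotent_bkDiffUnit k s r' t _)
      (isUnit_bkDiffUnit k r' t hc0)).symm
  have hzQ : Commute (bkQ k r r' χ) (bkNilpotent k s) :=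
    (commute_bkQ k (commute_bkNilpotent k s) r r' χ).symm
  exact (hzP₂.mul_left hzQ).mul_left hzP

/-- `C` commutes with every `y_s`. [folklore] -/
theorem commute_bkTwistC_bkNilpotent {r r' t : Fin n} {χ : Fin n → k} (hk : χ r ≠ χ t) (s : Fin n) :
    Commute (bkTwistC k r r' t χ) (bkNilpotent k s) := by
  have hc0 : χ r - χ t ≠ 0 := sub_ne_zero.2 hk
  have hzK := commute_bkTwistK_bkNilpotent k (r' := r') hk s
  have hzP : Commute (Ring.inverse (bkDiffUnit k r t (χ r - χ t))) (bkNilpotent k s) :=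
    (commute_ringInverse_of_commute (commute_bkNilpotent_bkDiffUnit k s r t _)
      (isUnit_bkDiffUnit k r t hc0)).symm
  have hzP₂ : Commute (Ring.inverse (bkDiffUnit k r' t (χ r - χ t))) (bkNilpotent k s) :=
    (commute_ringInverse_of_commute (commute_bkNilpotent_bkDiffUnit k s r' t _)
      (isUnit_bkDiffUnit k r' t hc0)).symm
  unfold bkTwistC
  split_ifs
  · exact hzK.neg_left
  · exact ((hzP₂.mul_left hzK).add_left (hzK.mul_left hzP)).sub_left hzK
  · exact Commute.zero_left _
  · exact hzK.neg_left

/-- `C'` commutes with every `y_s`. [folklore] -/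
theorem commute_bkTwistC'_bkNilpotent {r r' t : Fin n} {χ : Fin n → k} (hk : χ r ≠ χ t) (s : Fin n) :
    Commute (bkTwistC' k r r' t χ) (bkNilpotent k s) := by
  have hc0 : χ r - χ t ≠ 0 := sub_ne_zero.2 hk
  have hzK := commute_bkTwistK_bkNilpotent k (r' := r') hk s
  have hzP : Commute (Ring.inverse (bkDiffUnit k r t (χ r - χ t))) (bkNilpotent k s) :=
    (commute_ringInverse_of_commute (commute_bkNilpotent_bkDiffUnit k s r t _)
      (isUnit_bkDiffUnit k r t hc0)).symm
  have hzP₂ : Commute (Ring.inverse (bkDiffUnit k r' t (χ r - χ t))) (bkNilpotent k s) :=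
    (commute_ringInverse_of_commute (commute_bkNilpotent_bkDiffUnit k s r' t _)
      (isUnit_bkDiffUnit k r' t hc0)).symm
  unfold bkTwistC'
  split_ifs
  · exact hzK
  · exact Commute.zero_left _
  · exact ((hzP₂.mul_left hzK).add_left (hzK.mul_left hzP)).add_left hzK
  · exact hzK

/-- **The twisted exchange of `q_{(r,t)}(𝐢)`, `q_{(r+1,t)}(𝐢)` through `φ_r` on `M_𝐢`
(`i_r = i_{r+1} ≠ i_t`, `t ∉ {r, r+1}`): `φ_r q_{(r,t)} w = q_{(r+1,t)} φ_r w + C w` and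
`φ_r q_{(r+1,t)} w = q_{(r,t)} φ_r w - C w`** with the explicit `C = bkTwistC` — Brundan–Kleshchev's
`ψ_r f − ({}^{s_r}f)ψ_r = ∂_r(f)` for these `f`, by the four quiver cases for the explicit `q` of
BK (3.30). [folklore] -/
theorem bkPhi_mul_bkQ_mul_of_mem_eq_last {r r' t : Fin n} (h : (r' : ℕ) = r + 1)
    (htr : t ≠ r) (htr' : t ≠ r') {χ : Fin n → k} (hc : χ r = χ r') (hk : χ r ≠ χ t) :
    (∀ v ∈ jointEigenspace k χ, bkPhi k r r' * (bkQ k r t χ * v) =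
        bkQ k r' t χ * (bkPhi k r r' * v) + bkTwistC k r r' t χ * v) ∧
      (∀ v ∈ jointEigenspace k χ, bkPhi k r r' * (bkQ k r' t χ * v) =
        bkQ k r t χ * (bkPhi k r r' * v) - bkTwistC k r r' t χ * v) := by
  have hk' : χ r' ≠ χ t := hc ▸ hk
  have hc0 : χ r - χ t ≠ 0 := sub_ne_zero.2 hk
  have hu : IsUnit (bkDiffUnit k r t (χ r - χ t)) := isUnit_bkDiffUnit k r t hc0
  have hu' : IsUnit (bkDiffUnit k r' t (χ r - χ t)) := isUnit_bkDiffUnit k r' t hc0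
  have hbkP : bkP k r t χ = Ring.inverse (bkDiffUnit k r t (χ r - χ t)) := by rw [bkP, if_neg hk]
  have hbkP₂ : bkP k r' t χ = Ring.inverse (bkDiffUnit k r' t (χ r - χ t)) := by
    rw [bkP, if_neg hk', ← hc]
  have hzP : ∀ s, Commute (Ring.inverse (bkDiffUnit k r t (χ r - χ t))) (bkNilpotent k s) :=
    fun s => (commute_ringInverse_of_commute (commute_bkNilpotent_bkDiffUnit k s r t _) hu).symm
  have hzP₂ : ∀ s, Commute (Ring.inverse (bkDiffUnit k r' t (χ r - χ t))) (bkNilpotent k s) :=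
    fun s => (commute_ringInverse_of_commute (commute_bkNilpotent_bkDiffUnit k s r' t _) hu').symm
  have cPQ : Commute (Ring.inverse (bkDiffUnit k r t (χ r - χ t))) (bkQ k r r' χ) :=
    commute_bkQ k hzP r r' χ
  have cP₂Q : Commute (Ring.inverse (bkDiffUnit k r' t (χ r - χ t))) (bkQ k r r' χ) :=
    commute_bkQ k hzP₂ r r' χ
  have cPP₂ : Commute (Ring.inverse (bkDiffUnit k r t (χ r - χ t)))
      (Ring.inverse (bkDiffUnit k r' t (χ r - χ t))) :=
    commute_ringInverse_of_commute
      (commute_ringInverse_of_commute (commute_bkDiffUnit k r' t r t _ _) hu).symm hu'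
  have hKdef : bkTwistK k r r' t χ = Ring.inverse (bkDiffUnit k r' t (χ r - χ t)) * bkQ k r r' χ *
      Ring.inverse (bkDiffUnit k r t (χ r - χ t)) := rfl
  have cPK : Commute (Ring.inverse (bkDiffUnit k r t (χ r - χ t))) (bkTwistK k r r' t χ) :=
    (cPP₂.mul_right cPQ).mul_right (Commute.refl _)
  have cP₂K : Commute (Ring.inverse (bkDiffUnit k r' t (χ r - χ t))) (bkTwistK k r r' t χ) :=
    ((Commute.refl _).mul_right cP₂Q).mul_right cPP₂.symm
  have hK' : Ring.inverse (bkDiffUnit k r t (χ r - χ t)) * bkQ k r r' χ *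
      Ring.inverse (bkDiffUnit k r' t (χ r - χ t)) = bkTwistK k r r' t χ := by
    rw [hKdef, cPQ.eq, mul_assoc, cPP₂.eq, ← mul_assoc, ← cP₂Q.eq]
  have hPM : ∀ v ∈ jointEigenspace k χ,
      Ring.inverse (bkDiffUnit k r t (χ r - χ t)) * v ∈ jointEigenspace k χ :=
    fun v hv => ringInverse_bkDiffUnit_mul_mem k r t hc0 hv
  have hP₂M : ∀ v ∈ jointEigenspace k χ,
      Ring.inverse (bkDiffUnit k r' t (χ r - χ t)) * v ∈ jointEigenspace k χ :=
    fun v hv => ringInverse_bkDiffUnit_mul_mem k r' t hc0 hv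
  have hPr : ∀ v ∈ jointEigenspace k χ,
      bkPhi k r r' * (Ring.inverse (bkDiffUnit k r t (χ r - χ t)) * v) =
        Ring.inverse (bkDiffUnit k r' t (χ r - χ t)) * (bkPhi k r r' * v) +
          bkTwistK k r r' t χ * v := by
    intro v hv
    rw [bkPhi_mul_bkPinv_mul_of_mem_eq_left k h htr htr' hc hv hc0, hKdef, mul_assoc, mul_assoc]
  have hP₂r : ∀ v ∈ jointEigenspace k χ,
      bkPhi k r r' * (Ring.inverse (bkDiffUnit k r' t (χ r - χ t)) * v) =
        Ring.inverse (bkDiffUnit k r t (χ r - χ t)) * (bkPhi k r r' * v) -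
          bkTwistK k r r' t χ * v := by
    intro v hv
    rw [bkPhi_mul_bkPinv_mul_of_mem_eq_right k h htr htr' hc hv hc0, ← hK', mul_assoc, mul_assoc]
  unfold bkTwistC
  by_cases h1 : χ t = χ r + 1 <;> by_cases h2 : χ r = χ t + 1
  · -- `i ⇄ k`: `T = -P`, `q₂ = -P₂`, `C = -K`
    rw [if_pos h1, if_pos h2]
    have hT : bkQ k r t χ = -Ring.inverse (bkDiffUnit k r t (χ r - χ t)) := by
      rw [bkQ, if_neg hk, if_pos h1, if_pos h2, hbkP]
    have hq₂ : bkQ k r' t χ = -Ring.inverse (bkDiffUnit k r' t (χ r - χ t)) := by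
      rw [bkQ, if_neg hk', hbkP₂]
      simp only [← hc, if_pos h1, if_pos h2]
    refine ⟨fun v hv => ?_, fun v hv => ?_⟩
    · rw [hT, hq₂, neg_mul, mul_neg, hPr v hv, neg_mul, neg_mul]; abel
    · rw [hT, hq₂, neg_mul, mul_neg, hP₂r v hv, neg_mul, neg_mul]; abel
  · -- `i → k`: `T = P² - P`, `q₂ = P₂² - P₂`, `C = P₂ K + K P - K`
    rw [if_pos h1, if_neg h2]
    have hT : bkQ k r t χ = Ring.inverse (bkDiffUnit k r t (χ r - χ t)) *
        Ring.inverse (bkDiffUnit k r t (χ r - χ t)) - Ring.inverse (bkDiffUnit k r t (χ r - χ t)) := by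
      rw [bkQ, if_neg hk, if_pos h1, if_neg h2, hbkP]
    have hq₂ : bkQ k r' t χ = Ring.inverse (bkDiffUnit k r' t (χ r - χ t)) *
        Ring.inverse (bkDiffUnit k r' t (χ r - χ t)) -
          Ring.inverse (bkDiffUnit k r' t (χ r - χ t)) := by
      rw [bkQ, if_neg hk', hbkP₂]
      simp only [← hc, if_pos h1, if_neg h2]
    refine ⟨fun v hv => ?_, fun v hv => ?_⟩
    · rw [hT, hq₂, sub_mul, mul_assoc _ _ v, mul_sub, hPr _ (hPM v hv), hPr v hv, mul_add,
        sub_mul _ _ (bkPhi k r r' * v), sub_mul _ _ v, add_mul _ _ v]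
      simp only [mul_assoc]
      abel
    · rw [hT, hq₂, sub_mul, mul_assoc _ _ v, mul_sub, hP₂r _ (hP₂M v hv), hP₂r v hv, mul_sub,
        ← mul_assoc (Ring.inverse (bkDiffUnit k r t (χ r - χ t))) (bkTwistK k r r' t χ) v, cPK.eq,
        cP₂K.eq, sub_mul _ _ (bkPhi k r r' * v), sub_mul _ _ v, add_mul _ _ v]
      simp only [mul_assoc]
      abel
  · -- `i ← k`: `T = 1 = q₂`, `C = 0`
    rw [if_neg h1, if_pos h2]
    have hT : bkQ k r t χ = 1 := by rw [bkQ, if_neg hk, if_neg h1, if_pos h2]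
    have hq₂ : bkQ k r' t χ = 1 := by
      rw [bkQ, if_neg hk']
      simp only [← hc, if_neg h1, if_pos h2]
    refine ⟨fun v _ => ?_, fun v _ => ?_⟩
    · rw [hT, hq₂, one_mul, one_mul, zero_mul, add_zero]
    · rw [hT, hq₂, one_mul, one_mul, zero_mul, sub_zero]
  · -- unrelated: `T = 1 - P`, `q₂ = 1 - P₂`, `C = -K`
    rw [if_neg h1, if_neg h2]
    have hT : bkQ k r t χ = 1 - Ring.inverse (bkDiffUnit k r t (χ r - χ t)) := by
      rw [bkQ, if_neg hk, if_neg h1, if_neg h2, hbkP]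
    have hq₂ : bkQ k r' t χ = 1 - Ring.inverse (bkDiffUnit k r' t (χ r - χ t)) := by
      rw [bkQ, if_neg hk', hbkP₂]
      simp only [← hc, if_neg h1, if_neg h2]
    refine ⟨fun v hv => ?_, fun v hv => ?_⟩
    · rw [hT, hq₂, sub_mul, one_mul, mul_sub, hPr v hv, sub_mul, one_mul, neg_mul]; abel
    · rw [hT, hq₂, sub_mul, one_mul, mul_sub, hP₂r v hv, sub_mul, one_mul, neg_mul]; abel

/-- **The twisted exchange of `q_{(t,r)}(𝐢)`, `q_{(t,r+1)}(𝐢)` through `φ_r` on `M_𝐢`**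
(`i_r = i_{r+1} ≠ i_t`), with the explicit `C' = bkTwistC'`. [folklore] -/
theorem bkPhi_mul_bkQ_mul_of_mem_eq_first {r r' t : Fin n} (h : (r' : ℕ) = r + 1)
    (htr : t ≠ r) (htr' : t ≠ r') {χ : Fin n → k} (hc : χ r = χ r') (hk : χ r ≠ χ t) :
    (∀ v ∈ jointEigenspace k χ, bkPhi k r r' * (bkQ k t r χ * v) =
        bkQ k t r' χ * (bkPhi k r r' * v) + bkTwistC' k r r' t χ * v) ∧
      (∀ v ∈ jointEigenspace k χ, bkPhi k r r' * (bkQ k t r' χ * v) =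
        bkQ k t r χ * (bkPhi k r r' * v) - bkTwistC' k r r' t χ * v) := by
  have hk' : χ r' ≠ χ t := hc ▸ hk
  have hc0 : χ r - χ t ≠ 0 := sub_ne_zero.2 hk
  have hu : IsUnit (bkDiffUnit k r t (χ r - χ t)) := isUnit_bkDiffUnit k r t hc0
  have hu' : IsUnit (bkDiffUnit k r' t (χ r - χ t)) := isUnit_bkDiffUnit k r' t hc0
  have hbkP : bkP k t r χ = -Ring.inverse (bkDiffUnit k r t (χ r - χ t)) := bkP_swap k hk
  have hbkP₂ : bkP k t r' χ = -Ring.inverse (bkDiffUnit k r' t (χ r - χ t)) := by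
    rw [bkP_swap k hk', ← hc]
  have hzP : ∀ s, Commute (Ring.inverse (bkDiffUnit k r t (χ r - χ t))) (bkNilpotent k s) :=
    fun s => (commute_ringInverse_of_commute (commute_bkNilpotent_bkDiffUnit k s r t _) hu).symm
  have hzP₂ : ∀ s, Commute (Ring.inverse (bkDiffUnit k r' t (χ r - χ t))) (bkNilpotent k s) :=
    fun s => (commute_ringInverse_of_commute (commute_bkNilpotent_bkDiffUnit k s r' t _) hu').symm
  have cPQ : Commute (Ring.inverse (bkDiffUnit k r t (χ r - χ t))) (bkQ k r r' χ) :=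
    commute_bkQ k hzP r r' χ
  have cP₂Q : Commute (Ring.inverse (bkDiffUnit k r' t (χ r - χ t))) (bkQ k r r' χ) :=
    commute_bkQ k hzP₂ r r' χ
  have cPP₂ : Commute (Ring.inverse (bkDiffUnit k r t (χ r - χ t)))
      (Ring.inverse (bkDiffUnit k r' t (χ r - χ t))) :=
    commute_ringInverse_of_commute
      (commute_ringInverse_of_commute (commute_bkDiffUnit k r' t r t _ _) hu).symm hu'
  have hKdef : bkTwistK k r r' t χ = Ring.inverse (bkDiffUnit k r' t (χ r - χ t)) * bkQ k r r' χ *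
      Ring.inverse (bkDiffUnit k r t (χ r - χ t)) := rfl
  have cPK : Commute (Ring.inverse (bkDiffUnit k r t (χ r - χ t))) (bkTwistK k r r' t χ) :=
    (cPP₂.mul_right cPQ).mul_right (Commute.refl _)
  have cP₂K : Commute (Ring.inverse (bkDiffUnit k r' t (χ r - χ t))) (bkTwistK k r r' t χ) :=
    ((Commute.refl _).mul_right cP₂Q).mul_right cPP₂.symm
  have hK' : Ring.inverse (bkDiffUnit k r t (χ r - χ t)) * bkQ k r r' χ *
      Ring.inverse (bkDiffUnit k r' t (χ r - χ t)) = bkTwistK k r r' t χ := by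
    rw [hKdef, cPQ.eq, mul_assoc, cPP₂.eq, ← mul_assoc, ← cP₂Q.eq]
  have hPM : ∀ v ∈ jointEigenspace k χ,
      Ring.inverse (bkDiffUnit k r t (χ r - χ t)) * v ∈ jointEigenspace k χ :=
    fun v hv => ringInverse_bkDiffUnit_mul_mem k r t hc0 hv
  have hP₂M : ∀ v ∈ jointEigenspace k χ,
      Ring.inverse (bkDiffUnit k r' t (χ r - χ t)) * v ∈ jointEigenspace k χ :=
    fun v hv => ringInverse_bkDiffUnit_mul_mem k r' t hc0 hv
  have hPr : ∀ v ∈ jointEigenspace k χ,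
      bkPhi k r r' * (Ring.inverse (bkDiffUnit k r t (χ r - χ t)) * v) =
        Ring.inverse (bkDiffUnit k r' t (χ r - χ t)) * (bkPhi k r r' * v) +
          bkTwistK k r r' t χ * v := by
    intro v hv
    rw [bkPhi_mul_bkPinv_mul_of_mem_eq_left k h htr htr' hc hv hc0, hKdef, mul_assoc, mul_assoc]
  have hP₂r : ∀ v ∈ jointEigenspace k χ,
      bkPhi k r r' * (Ring.inverse (bkDiffUnit k r' t (χ r - χ t)) * v) =
        Ring.inverse (bkDiffUnit k r t (χ r - χ t)) * (bkPhi k r r' * v) -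
          bkTwistK k r r' t χ * v := by
    intro v hv
    rw [bkPhi_mul_bkPinv_mul_of_mem_eq_right k h htr htr' hc hv hc0, ← hK', mul_assoc, mul_assoc]
  have hkt : χ t ≠ χ r := Ne.symm hk
  have hkt' : χ t ≠ χ r' := Ne.symm hk'
  unfold bkTwistC'
  by_cases h1 : χ t = χ r + 1 <;> by_cases h2 : χ r = χ t + 1
  · -- `T = P`, `q₂ = P₂`, `C' = K`
    rw [if_pos h1, if_pos h2]
    have hT : bkQ k t r χ = Ring.inverse (bkDiffUnit k r t (χ r - χ t)) := by
      rw [bkQ, if_neg hkt, if_pos h2, if_pos h1, hbkP, neg_neg]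
    have hq₂ : bkQ k t r' χ = Ring.inverse (bkDiffUnit k r' t (χ r - χ t)) := by
      rw [bkQ, if_neg hkt', hbkP₂]
      simp only [← hc, if_pos h1, if_pos h2, neg_neg]
    exact ⟨fun v hv => by rw [hT, hq₂, hPr v hv], fun v hv => by rw [hT, hq₂, hP₂r v hv]⟩
  · -- only `i_t = i_r + 1`: `T = 1 = q₂`, `C' = 0`
    rw [if_pos h1, if_neg h2]
    have hT : bkQ k t r χ = 1 := by rw [bkQ, if_neg hkt, if_neg h2, if_pos h1]
    have hq₂ : bkQ k t r' χ = 1 := by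
      rw [bkQ, if_neg hkt']
      simp only [← hc, if_pos h1, if_neg h2]
    refine ⟨fun v _ => ?_, fun v _ => ?_⟩
    · rw [hT, hq₂, one_mul, one_mul, zero_mul, add_zero]
    · rw [hT, hq₂, one_mul, one_mul, zero_mul, sub_zero]
  · -- only `i_r = i_t + 1`: `T = P² + P`, `q₂ = P₂² + P₂`, `C' = P₂ K + K P + K`
    rw [if_neg h1, if_pos h2]
    have hT : bkQ k t r χ = Ring.inverse (bkDiffUnit k r t (χ r - χ t)) *
        Ring.inverse (bkDiffUnit k r t (χ r - χ t)) + Ring.inverse (bkDiffUnit k r t (χ r - χ t)) := by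
      rw [bkQ, if_neg hkt, if_pos h2, if_neg h1, hbkP, neg_mul_neg, sub_neg_eq_add]
    have hq₂ : bkQ k t r' χ = Ring.inverse (bkDiffUnit k r' t (χ r - χ t)) *
        Ring.inverse (bkDiffUnit k r' t (χ r - χ t)) +
          Ring.inverse (bkDiffUnit k r' t (χ r - χ t)) := by
      rw [bkQ, if_neg hkt', hbkP₂]
      simp only [← hc, if_neg h1, if_pos h2, neg_mul_neg, sub_neg_eq_add]
    refine ⟨fun v hv => ?_, fun v hv => ?_⟩
    · rw [hT, hq₂, add_mul, mul_assoc _ _ v, mul_add, hPr _ (hPM v hv), hPr v hv, mul_add,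
        add_mul _ _ (bkPhi k r r' * v), add_mul _ _ v, add_mul _ _ v]
      simp only [mul_assoc]
      abel
    · rw [hT, hq₂, add_mul, mul_assoc _ _ v, mul_add, hP₂r _ (hP₂M v hv), hP₂r v hv, mul_sub,
        ← mul_assoc (Ring.inverse (bkDiffUnit k r t (χ r - χ t))) (bkTwistK k r r' t χ) v, cPK.eq,
        cP₂K.eq, add_mul _ _ (bkPhi k r r' * v), add_mul _ _ v, add_mul _ _ v]
      simp only [mul_assoc]
      abel
  · -- unrelated: `T = 1 + P`, `q₂ = 1 + P₂`, `C' = K`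
    rw [if_neg h1, if_neg h2]
    have hT : bkQ k t r χ = 1 + Ring.inverse (bkDiffUnit k r t (χ r - χ t)) := by
      rw [bkQ, if_neg hkt, if_neg h2, if_neg h1, hbkP, sub_neg_eq_add]
    have hq₂ : bkQ k t r' χ = 1 + Ring.inverse (bkDiffUnit k r' t (χ r - χ t)) := by
      rw [bkQ, if_neg hkt', hbkP₂]
      simp only [← hc, if_neg h1, if_neg h2, sub_neg_eq_add]
    refine ⟨fun v hv => ?_, fun v hv => ?_⟩
    · rw [hT, hq₂, add_mul, one_mul, mul_add, hPr v hv, add_mul, one_mul]; abel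
    · rw [hT, hq₂, add_mul, one_mul, mul_add, hP₂r v hv, add_mul, one_mul]; abel

/-- **`φ_r (q_{(r,t)}^{-1} q_{(r+1,t)}^{-1}) w = (q_{(r,t)}^{-1} q_{(r+1,t)}^{-1}) φ_r w` on `M_𝐢`
for `i_r = i_{r+1} ≠ i_t`** (the product is `s_r`-invariant: "`∂_r f = 0`", Brundan–Kleshchev,
proof of Thm 3.2, Case 2). [folklore] -/
theorem bkPhi_mul_ringInverse_bkQ_pair_mul_of_mem_eq {r r' t : Fin n} (h : (r' : ℕ) = r + 1)
    (htr : t ≠ r) (htr' : t ≠ r') {χ : Fin n → k} (hc : χ r = χ r') (hk : χ r ≠ χ t)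
    {w : MonoidAlgebra k (Perm (Fin n))} (hw : w ∈ jointEigenspace k χ) :
    bkPhi k r r' * (Ring.inverse (bkQ k r t χ) * (Ring.inverse (bkQ k r' t χ) * w)) =
      Ring.inverse (bkQ k r t χ) * (Ring.inverse (bkQ k r' t χ) * (bkPhi k r r' * w)) := by
  obtain ⟨hT, hq₂⟩ := bkPhi_mul_bkQ_mul_of_mem_eq_last k h htr htr' hc hk
  have hzT : ∀ s, Commute (bkQ k r t χ) (bkNilpotent k s) :=
    fun s => (commute_bkQ k (commute_bkNilpotent k s) r t χ).symm
  refine bkPhi_mul_inv_mul_of_opposite k hT hq₂ (isUnit_bkQ k r t χ) (isUnit_bkQ k r' t χ)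
    (commute_bkQ k hzT r' t χ).eq (commute_bkQ k (commute_bkTwistC_bkNilpotent k hk) r' t χ).eq.symm
    (fun v hv => ?_) (fun v hv => ?_) (fun v hv => ?_) hw
  · exact mul_left_mem_jointEigenspace_of_comm k
      (fun s => (commute_ringInverse_bkQ k (commute_jucysMurphy_bkNilpotent k s) r t χ).eq) hv
  · exact mul_left_mem_jointEigenspace_of_comm k
      (fun s => (commute_ringInverse_bkQ k (commute_jucysMurphy_bkNilpotent k s) r' t χ).eq) hv
  · exact mul_left_mem_jointEigenspace_of_comm k
      (fun s => (commute_bkQ k (commute_jucysMurphy_bkNilpotent k s) r' t χ).eq) hv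

/-- … and the mirror: **`φ_r (q_{(t,r)}^{-1} q_{(t,r+1)}^{-1}) w = (q_{(t,r)}^{-1} q_{(t,r+1)}^{-1}) φ_r w`**.
[folklore] -/
theorem bkPhi_mul_ringInverse_bkQ_pair_mul_of_mem_eq' {r r' t : Fin n} (h : (r' : ℕ) = r + 1)
    (htr : t ≠ r) (htr' : t ≠ r') {χ : Fin n → k} (hc : χ r = χ r') (hk : χ r ≠ χ t)
    {w : MonoidAlgebra k (Perm (Fin n))} (hw : w ∈ jointEigenspace k χ) :
    bkPhi k r r' * (Ring.inverse (bkQ k t r χ) * (Ring.inverse (bkQ k t r' χ) * w)) =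
      Ring.inverse (bkQ k t r χ) * (Ring.inverse (bkQ k t r' χ) * (bkPhi k r r' * w)) := by
  obtain ⟨hT, hq₂⟩ := bkPhi_mul_bkQ_mul_of_mem_eq_first k h htr htr' hc hk
  have hzT : ∀ s, Commute (bkQ k t r χ) (bkNilpotent k s) :=
    fun s => (commute_bkQ k (commute_bkNilpotent k s) t r χ).symm
  refine bkPhi_mul_inv_mul_of_opposite k hT hq₂ (isUnit_bkQ k t r χ) (isUnit_bkQ k t r' χ)
    (commute_bkQ k hzT t r' χ).eq (commute_bkQ k (commute_bkTwistC'_bkNilpotent k hk) t r' χ).eq.symm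
    (fun v hv => ?_) (fun v hv => ?_) (fun v hv => ?_) hw
  · exact mul_left_mem_jointEigenspace_of_comm k
      (fun s => (commute_ringInverse_bkQ k (commute_jucysMurphy_bkNilpotent k s) t r χ).eq) hv
  · exact mul_left_mem_jointEigenspace_of_comm k
      (fun s => (commute_ringInverse_bkQ k (commute_jucysMurphy_bkNilpotent k s) t r' χ).eq) hv
  · exact mul_left_mem_jointEigenspace_of_comm k
      (fun s => (commute_bkQ k (commute_jucysMurphy_bkNilpotent k s) t r' χ).eq) hv

/-- (EI6), Case 2, on `M_𝐢`: `φ_rφ_{r+1}φ_r w = φ_{r+1}φ_rφ_{r+1} w` for `w ∈ M_𝐢`,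
`i_r = i_{r+1} ≠ i_{r+2}`. [folklore] -/
theorem bkPhi_braid_mul_of_mem_of_eq_ne {r r' r'' : Fin n} (h : (r' : ℕ) = r + 1)
    (h' : (r'' : ℕ) = r' + 1) {χ : Fin n → k} (h1 : χ r = χ r') (h2 : χ r' ≠ χ r'')
    {w : MonoidAlgebra k (Perm (Fin n))} (hw : w ∈ jointEigenspace k χ) :
    bkPhi k r r' * (bkPhi k r' r'' * (bkPhi k r r' * w)) =
      bkPhi k r' r'' * (bkPhi k r r' * (bkPhi k r' r'' * w)) := by
  have he := bkPhi_braid_of_eq_ne k h h' h1 h2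
  rw [← klrIdempotent_mul_of_mem k hw, ← mul_assoc, ← mul_assoc, ← mul_assoc, he]
  simp only [mul_assoc]

/-- **(R7), Case 2: `ψ_rψ_{r+1}ψ_r e(𝐢) = ψ_{r+1}ψ_rψ_{r+1} e(𝐢)` for `i_r = i_{r+1} ≠ i_{r+2}`**
(Brundan–Kleshchev Thm 3.2, (R7) "otherwise", Case 2 of the proof: both sides equal
`φφφ · q_1(𝐢)^{-1} q_{(r,r+2)}(𝐢)^{-1} q_2(𝐢)^{-1} e(𝐢)`, the `∂_1`-term vanishing because
`q_{(r,r+2)} q_2` is `s_r`-invariant). [folklore] -/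
theorem bkPsi_braid_of_eq_ne {r r' r'' : Fin n} (h : (r' : ℕ) = r + 1) (h' : (r'' : ℕ) = r' + 1)
    {χ : Fin n → k} (hc : χ r = χ r') (hk : χ r' ≠ χ r'') :
    bkPsi k r r' * bkPsi k r' r'' * bkPsi k r r' * klrIdempotent k χ =
      bkPsi k r' r'' * bkPsi k r r' * bkPsi k r' r'' * klrIdempotent k χ := by
  have hrr' : r ≠ r' := by intro e; rw [Fin.ext_iff] at e; omega
  have hr'r'' : r' ≠ r'' := by intro e; rw [Fin.ext_iff] at e; omega
  have hrr'' : r ≠ r'' := by intro e; rw [Fin.ext_iff] at e; omega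
  have hk' : χ r ≠ χ r'' := hc ▸ hk
  have hfix : χ ∘ swap r r' = χ := by
    funext x
    simp only [Function.comp_apply]
    by_cases e1 : x = r
    · subst e1; rw [swap_apply_left, hc]
    by_cases e2 : x = r'
    · subst e2; rw [swap_apply_right, hc]
    rw [swap_apply_of_ne_of_ne e1 e2]
  have hL : ∀ (x x' : Fin n) {w}, w ∈ jointEigenspace k χ →
      Ring.inverse (bkQ k x x' χ) * w ∈ jointEigenspace k χ := fun x x' w hw =>
    mul_left_mem_jointEigenspace_of_comm k
      (fun t => (commute_ringInverse_bkQ k (commute_jucysMurphy_bkNilpotent k t) x x' χ).eq) hw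
  have cQ : ∀ x x' z z' : Fin n, Commute (Ring.inverse (bkQ k x x' χ)) (Ring.inverse (bkQ k z z' χ)) :=
    fun x x' z z' => (commute_bkQ k (fun t => (commute_bkQ k (commute_bkNilpotent k t) x x' χ).symm)
      z z' χ).ringInverse_ringInverse
  -- the right-hand side: plain exchanges only
  have hb2 : (χ ∘ swap r' r'') r ≠ (χ ∘ swap r' r'') r' := by
    simp [swap_apply_left, swap_apply_of_ne_of_ne hrr' hrr'']; exact hk'
  rw [bkPsi_triple_mul_klrIdempotent_eq k h h' hk hb2]
  simp only [swap_apply_left, swap_apply_right, swap_apply_of_ne_of_ne hrr' hrr'']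
  -- the left-hand side
  have hv : Ring.inverse (bkQ k r r' χ) * klrIdempotent k χ ∈ jointEigenspace k χ :=
    hL r r' (klrIdempotent_mem k χ)
  have hφv : bkPhi k r r' * (Ring.inverse (bkQ k r r' χ) * klrIdempotent k χ) ∈ jointEigenspace k χ := by
    have := bkPhi_mul_mem k h hv
    rwa [hfix] at this
  have hu : Ring.inverse (bkQ k r' r'' χ) *
      (bkPhi k r r' * (Ring.inverse (bkQ k r r' χ) * klrIdempotent k χ)) ∈ jointEigenspace k χ :=
    hL r' r'' hφv
  have hex := bkPhi_mul_ringInverse_bkQ_mul_of_mem_gen k h' hk hu r r'' χ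
  rw [swap_apply_of_ne_of_ne hrr' hrr'', swap_apply_right] at hex
  rw [mul_assoc, mul_assoc, bkPsi_mul_of_mem k r r' (klrIdempotent_mem k χ),
    bkPsi_mul_of_mem k r' r'' hφv, bkPsi_mul_of_mem k r r' (bkPhi_mul_mem k h' hu), ← hex,
    ← bkPhi_mul_ringInverse_bkQ_pair_mul_of_mem_eq k h (Ne.symm hrr'') (Ne.symm hr'r'') hc hk' hv,
    bkPhi_braid_mul_of_mem_of_eq_ne k h h' hc hk (hL _ _ (hL _ _ hv))]
  simp only [swap_apply_right, swap_apply_of_ne_of_ne (Ne.symm hrr'') (Ne.symm hr'r'')]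
  rw [(cQ r' r'' r r').left_comm (klrIdempotent k χ),
    (cQ r r'' r r').left_comm (Ring.inverse (bkQ k r' r'' χ) * klrIdempotent k χ)]


/-- (EI6), Case 3, on `M_𝐢`: `φ_rφ_{r+1}φ_r w = φ_{r+1}φ_rφ_{r+1} w` for `w ∈ M_𝐢`,
`i_r ≠ i_{r+1} = i_{r+2}`. [folklore] -/
theorem bkPhi_braid_mul_of_mem_of_ne_eq {r r' r'' : Fin n} (h : (r' : ℕ) = r + 1)
    (h' : (r'' : ℕ) = r' + 1) {χ : Fin n → k} (h1 : χ r ≠ χ r') (h2 : χ r' = χ r'')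
    {w : MonoidAlgebra k (Perm (Fin n))} (hw : w ∈ jointEigenspace k χ) :
    bkPhi k r r' * (bkPhi k r' r'' * (bkPhi k r r' * w)) =
      bkPhi k r' r'' * (bkPhi k r r' * (bkPhi k r' r'' * w)) := by
  have he := bkPhi_braid_of_ne_eq k h h' h1 h2
  rw [← klrIdempotent_mul_of_mem k hw, ← mul_assoc, ← mul_assoc, ← mul_assoc, he]
  simp only [mul_assoc]

/-- **(R7), Case 3: `ψ_rψ_{r+1}ψ_r e(𝐢) = ψ_{r+1}ψ_rψ_{r+1} e(𝐢)` for `i_r ≠ i_{r+1} = i_{r+2}`**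
(Brundan–Kleshchev Thm 3.2, (R7) "otherwise", Case 3 of the proof). [folklore] -/
theorem bkPsi_braid_of_ne_eq {r r' r'' : Fin n} (h : (r' : ℕ) = r + 1) (h' : (r'' : ℕ) = r' + 1)
    {χ : Fin n → k} (hij : χ r ≠ χ r') (heq : χ r' = χ r'') :
    bkPsi k r r' * bkPsi k r' r'' * bkPsi k r r' * klrIdempotent k χ =
      bkPsi k r' r'' * bkPsi k r r' * bkPsi k r' r'' * klrIdempotent k χ := by
  have hrr' : r ≠ r' := by intro e; rw [Fin.ext_iff] at e; omega
  have hr'r'' : r' ≠ r'' := by intro e; rw [Fin.ext_iff] at e; omega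
  have hrr'' : r ≠ r'' := by intro e; rw [Fin.ext_iff] at e; omega
  have hik : χ r ≠ χ r'' := heq ▸ hij
  have hfix : χ ∘ swap r' r'' = χ := by
    funext x
    simp only [Function.comp_apply]
    by_cases e1 : x = r'
    · subst e1; rw [swap_apply_left, heq]
    by_cases e2 : x = r''
    · subst e2; rw [swap_apply_right, heq]
    rw [swap_apply_of_ne_of_ne e1 e2]
  have hL : ∀ (x x' : Fin n) {w}, w ∈ jointEigenspace k χ →
      Ring.inverse (bkQ k x x' χ) * w ∈ jointEigenspace k χ := fun x x' w hw =>
    mul_left_mem_jointEigenspace_of_comm k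
      (fun t => (commute_ringInverse_bkQ k (commute_jucysMurphy_bkNilpotent k t) x x' χ).eq) hw
  have cQ : ∀ x x' z z' : Fin n, Commute (Ring.inverse (bkQ k x x' χ)) (Ring.inverse (bkQ k z z' χ)) :=
    fun x x' z z' => (commute_bkQ k (fun t => (commute_bkQ k (commute_bkNilpotent k t) x x' χ).symm)
      z z' χ).ringInverse_ringInverse
  -- the left-hand side: plain exchanges only
  have hb1 : (χ ∘ swap r r') r' ≠ (χ ∘ swap r r') r'' := by
    simp [swap_apply_right, swap_apply_of_ne_of_ne (Ne.symm hrr'') (Ne.symm hr'r'')]; exact hik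
  rw [bkPsi_triple_mul_klrIdempotent_eq k h' h hij hb1]
  simp only [swap_apply_left, swap_apply_right, swap_apply_of_ne_of_ne hrr' hrr'',
    swap_apply_of_ne_of_ne (Ne.symm hrr'') (Ne.symm hr'r'')]
  -- the right-hand side
  have hv : Ring.inverse (bkQ k r' r'' χ) * klrIdempotent k χ ∈ jointEigenspace k χ :=
    hL r' r'' (klrIdempotent_mem k χ)
  have hφv : bkPhi k r' r'' * (Ring.inverse (bkQ k r' r'' χ) * klrIdempotent k χ) ∈
      jointEigenspace k χ := by
    have := bkPhi_mul_mem k h' hv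
    rwa [hfix] at this
  have hu : Ring.inverse (bkQ k r r' χ) *
      (bkPhi k r' r'' * (Ring.inverse (bkQ k r' r'' χ) * klrIdempotent k χ)) ∈ jointEigenspace k χ :=
    hL r r' hφv
  have hex := bkPhi_mul_ringInverse_bkQ_mul_of_mem_gen k h hij hu r r'' χ
  rw [swap_apply_left, swap_apply_of_ne_of_ne (Ne.symm hrr'') (Ne.symm hr'r'')] at hex
  have hpair := bkPhi_mul_ringInverse_bkQ_pair_mul_of_mem_eq' k h' hrr' hrr'' heq (Ne.symm hij) hv
  rw [mul_assoc, mul_assoc, bkPsi_mul_of_mem k r' r'' (klrIdempotent_mem k χ),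
    bkPsi_mul_of_mem k r r' hφv, bkPsi_mul_of_mem k r' r'' (bkPhi_mul_mem k h hu), ← hex,
    (cQ r r'' r r').left_comm (bkPhi k r' r'' * (Ring.inverse (bkQ k r' r'' χ) * klrIdempotent k χ)),
    ← hpair, bkPhi_braid_mul_of_mem_of_ne_eq k h h' hij heq
      (hL _ _ (hL _ _ (hL r r' (klrIdempotent_mem k χ))))]
  rw [(cQ r r'' r r').left_comm (klrIdempotent k χ),
    (cQ r' r'' r r').left_comm (Ring.inverse (bkQ k r r'' χ) * klrIdempotent k χ),
    (cQ r' r'' r r'').left_comm (klrIdempotent k χ)]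

end BKPartial


/-! ### The commutative `y`-algebra (double commutant of `y_1, …, y_n`) -/

section YAlg

open Equiv

variable (k : Type*) [Field k] [DecidableEq k] (n : ℕ)

/-- The double commutant of `{y_1, …, y_n}` in `k[S_n]`: a commutative subalgebra containing the
`y_r`, the difference units, the `p_r(𝐢)`, `q_r(𝐢)` and the inverses of its units — the home of
Brundan–Kleshchev's power series in `y_1, …, y_d` (here honest elements). [folklore] -/
def yAlg : Subalgebra k (MonoidAlgebra k (Perm (Fin n))) :=
  Subalgebra.centralizer k (Set.centralizer (Set.range (bkNilpotent k (n := n))))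

variable {n}

/-- Membership in `Y''`. [folklore] -/
theorem mem_yAlg_iff {z : MonoidAlgebra k (Perm (Fin n))} :
    z ∈ yAlg k n ↔ ∀ g ∈ Set.centralizer (Set.range (bkNilpotent k (n := n))), g * z = z * g :=
  Subalgebra.mem_centralizer_iff k

/-- `y_t ∈ Y''`. [folklore] -/
theorem bkNilpotent_mem_yAlg (t : Fin n) : bkNilpotent k t ∈ yAlg k n :=
  (mem_yAlg_iff k).2 fun _ hg => (hg _ ⟨t, rfl⟩).symm

/-- `Y''` is closed under inverses of units of `k[S_n]`. [folklore] -/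
theorem ringInverse_mem_yAlg {u : MonoidAlgebra k (Perm (Fin n))} (hu : u ∈ yAlg k n)
    (hunit : IsUnit u) : Ring.inverse u ∈ yAlg k n :=
  (mem_yAlg_iff k).2 fun g hg => (commute_ringInverse_of_commute (((mem_yAlg_iff k).1 hu g hg)) hunit).eq

/-- `Y''` is commutative. [folklore] -/
instance isMulCommutative_yAlg : IsMulCommutative (yAlg k n) :=
  ⟨⟨fun a b => Subtype.ext (Set.centralizer_centralizer_comm_of_comm (fun x hx y hy => by
    obtain ⟨s, rfl⟩ := hx
    obtain ⟨t, rfl⟩ := hy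
    exact (commute_bkNilpotent k s t).eq) a.1 a.2 b.1 b.2)⟩⟩

/-- Difference units lie in `Y''`. [folklore] -/
theorem bkDiffUnit_mem_yAlg (a b : Fin n) (c : k) : bkDiffUnit k a b c ∈ yAlg k n :=
  add_mem (Subalgebra.algebraMap_mem _ c)
    (sub_mem (bkNilpotent_mem_yAlg k a) (bkNilpotent_mem_yAlg k b))

/-- `p_a(𝐣) ∈ Y''`. [folklore] -/
theorem bkP_mem_yAlg (a a' : Fin n) (ψ : Fin n → k) : bkP k a a' ψ ∈ yAlg k n := by
  unfold bkP
  split_ifs with h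
  · exact one_mem _
  · exact ringInverse_mem_yAlg k (bkDiffUnit_mem_yAlg k a a' _)
      (isUnit_bkDiffUnit k a a' (sub_ne_zero.2 h))

/-- `q_a(𝐣) ∈ Y''`. [folklore] -/
theorem bkQ_mem_yAlg (a a' : Fin n) (ψ : Fin n → k) : bkQ k a a' ψ ∈ yAlg k n := by
  have hp := bkP_mem_yAlg k a a' ψ
  unfold bkQ
  split_ifs
  · exact add_mem (one_mem _) (sub_mem (bkNilpotent_mem_yAlg k a') (bkNilpotent_mem_yAlg k a))
  · exact neg_mem hp
  · exact sub_mem (mul_mem hp hp) hp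
  · exact one_mem _
  · exact sub_mem (one_mem _) hp

/-- `e(𝐣)` commutes with `{y_t}`, i.e. lies in `Y'`. [folklore] -/
theorem klrIdempotent_mem_centralizer (ψ : Fin n → k) :
    klrIdempotent k ψ ∈ Set.centralizer (Set.range (bkNilpotent k (n := n))) := by
  rintro _ ⟨t, rfl⟩
  exact (commute_klrIdempotent_bkNilpotent k ψ t).symm.eq

/-- Elements of `Y''` commute with the Jucys–Murphy elements. [folklore] -/
theorem commute_jucysMurphy_of_mem_yAlg {z : MonoidAlgebra k (Perm (Fin n))} (hz : z ∈ yAlg k n)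
    (t : Fin n) : Commute (jucysMurphy k t) z := by
  rw [jucysMurphy_eq_bkNilpotent_add k t]
  refine Commute.add_left ?_ (Commute.sum_left _ _ _ fun ψ _ => Commute.smul_left ?_ _)
  · exact (mem_yAlg_iff k).1 hz _ (by rintro _ ⟨s, rfl⟩; exact (commute_bkNilpotent k s t).eq)
  · exact (mem_yAlg_iff k).1 hz _ (klrIdempotent_mem_centralizer k ψ)

/-- Left multiplication by an element of `Y''` preserves each `M_𝐢`. [folklore] -/
theorem mul_mem_jointEigenspace_of_mem_yAlg {z : MonoidAlgebra k (Perm (Fin n))} (hz : z ∈ yAlg k n)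
    {χ : Fin n → k} {w : MonoidAlgebra k (Perm (Fin n))} (hw : w ∈ jointEigenspace k χ) :
    z * w ∈ jointEigenspace k χ :=
  mul_left_mem_jointEigenspace_of_comm k (fun t => (commute_jucysMurphy_of_mem_yAlg k hz t).eq) hw

/-- `q_a(𝐣)^{-1} ∈ Y''`. [folklore] -/
theorem ringInverse_bkQ_mem_yAlg (a a' : Fin n) (ψ : Fin n → k) :
    Ring.inverse (bkQ k a a' ψ) ∈ yAlg k n :=
  ringInverse_mem_yAlg k (bkQ_mem_yAlg k a a' ψ) (isUnit_bkQ k a a' ψ)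

/-- `K ∈ Y''`. [folklore] -/
theorem bkTwistK_mem_yAlg (b b' t : Fin n) (ψ : Fin n → k) (hct : ψ b ≠ ψ t) :
    bkTwistK k b b' t ψ ∈ yAlg k n :=
  mul_mem (mul_mem (ringInverse_mem_yAlg k (bkDiffUnit_mem_yAlg k b' t _)
    (isUnit_bkDiffUnit k b' t (sub_ne_zero.2 hct))) (bkQ_mem_yAlg k b b' ψ))
    (ringInverse_mem_yAlg k (bkDiffUnit_mem_yAlg k b t _) (isUnit_bkDiffUnit k b t (sub_ne_zero.2 hct)))

/-- `C ∈ Y''`. [folklore] -/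
theorem bkTwistC_mem_yAlg (b b' t : Fin n) (ψ : Fin n → k) (hct : ψ b ≠ ψ t) :
    bkTwistC k b b' t ψ ∈ yAlg k n := by
  have hK := bkTwistK_mem_yAlg k b b' t ψ hct
  have hP := ringInverse_mem_yAlg k (bkDiffUnit_mem_yAlg k b t (ψ b - ψ t))
    (isUnit_bkDiffUnit k b t (sub_ne_zero.2 hct))
  have hP₂ := ringInverse_mem_yAlg k (bkDiffUnit_mem_yAlg k b' t (ψ b - ψ t))
    (isUnit_bkDiffUnit k b' t (sub_ne_zero.2 hct))
  unfold bkTwistC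
  split_ifs
  · exact neg_mem hK
  · exact sub_mem (add_mem (mul_mem hP₂ hK) (mul_mem hK hP)) hK
  · exact zero_mem _
  · exact neg_mem hK

/-- `C' ∈ Y''`. [folklore] -/
theorem bkTwistC'_mem_yAlg (b b' t : Fin n) (ψ : Fin n → k) (hct : ψ b ≠ ψ t) :
    bkTwistC' k b b' t ψ ∈ yAlg k n := by
  have hK := bkTwistK_mem_yAlg k b b' t ψ hct
  have hP := ringInverse_mem_yAlg k (bkDiffUnit_mem_yAlg k b t (ψ b - ψ t))
    (isUnit_bkDiffUnit k b t (sub_ne_zero.2 hct))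
  have hP₂ := ringInverse_mem_yAlg k (bkDiffUnit_mem_yAlg k b' t (ψ b - ψ t))
    (isUnit_bkDiffUnit k b' t (sub_ne_zero.2 hct))
  unfold bkTwistC'
  split_ifs
  · exact hK
  · exact zero_mem _
  · exact add_mem (add_mem (mul_mem hP₂ hK) (mul_mem hK hP)) hK
  · exact hK

/-- **Inverting a twisted rule: if `φ f w = f^s φ w + C w` on `M_𝐢` then
`φ f^{-1} w = (f^s)^{-1} φ w - (f^s)^{-1} C f^{-1} w`** (`∂` of an inverse). [folklore] -/
theorem bkPhi_mul_ringInverse_mul_of_rule {r r' : Fin n} {χ : Fin n → k}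
    {f fs C : MonoidAlgebra k (Perm (Fin n))}
    (hf : ∀ w ∈ jointEigenspace k χ, bkPhi k r r' * (f * w) = fs * (bkPhi k r r' * w) + C * w)
    (hu : IsUnit f) (hus : IsUnit fs)
    (hfM : ∀ w ∈ jointEigenspace k χ, Ring.inverse f * w ∈ jointEigenspace k χ)
    {w : MonoidAlgebra k (Perm (Fin n))} (hw : w ∈ jointEigenspace k χ) :
    bkPhi k r r' * (Ring.inverse f * w) =
      Ring.inverse fs * (bkPhi k r r' * w) - Ring.inverse fs * (C * (Ring.inverse f * w)) := by
  have key := hf _ (hfM w hw)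
  rw [← mul_assoc f, Ring.mul_inverse_cancel _ hu, one_mul] at key
  have key' : fs * (bkPhi k r r' * (Ring.inverse f * w)) =
      bkPhi k r r' * w - C * (Ring.inverse f * w) := eq_sub_of_add_eq key.symm
  calc bkPhi k r r' * (Ring.inverse f * w)
      = Ring.inverse fs * (fs * (bkPhi k r r' * (Ring.inverse f * w))) := by
        rw [← mul_assoc (Ring.inverse fs), Ring.inverse_mul_cancel _ hus, one_mul]
    _ = _ := by rw [key', mul_sub]

/-- Plain exchange of `K` through `φ_r` on `M_𝐢` (`i_r ≠ i_{r+1}`): the positions and the residue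
sequence travel with `s_r`. [folklore] -/
theorem bkPhi_mul_bkTwistK_mul_of_mem_gen {r r' : Fin n} (h : (r' : ℕ) = r + 1)
    {χ : Fin n → k} (hc : χ r ≠ χ r') {w : MonoidAlgebra k (Perm (Fin n))}
    (hw : w ∈ jointEigenspace k χ) (b b' t : Fin n) (ψ : Fin n → k) (hct : ψ b ≠ ψ t) :
    bkPhi k r r' * (bkTwistK k b b' t ψ * w) =
      bkTwistK k (swap r r' b) (swap r r' b') (swap r r' t) (ψ ∘ swap r r') * (bkPhi k r r' * w) := by
  have hc0 : ψ b - ψ t ≠ 0 := sub_ne_zero.2 hct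
  have hm1 : Ring.inverse (bkDiffUnit k b t (ψ b - ψ t)) * w ∈ jointEigenspace k χ :=
    mul_mem_jointEigenspace_of_mem_yAlg k (ringInverse_mem_yAlg k (bkDiffUnit_mem_yAlg k b t _)
      (isUnit_bkDiffUnit k b t hc0)) hw
  have hm2 := mul_mem_jointEigenspace_of_mem_yAlg k (bkQ_mem_yAlg k b b' ψ) hm1
  unfold bkTwistK
  simp only [Function.comp_apply, swap_apply_self]
  rw [mul_assoc, mul_assoc, bkPhi_mul_ringInverse_bkDiffUnit_mul_of_mem_gen k h hc hm2 b' t hc0,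
    bkPhi_mul_bkQ_mul_of_mem_gen k h hc hm1 b b' ψ,
    bkPhi_mul_ringInverse_bkDiffUnit_mul_of_mem_gen k h hc hw b t hc0, mul_assoc, mul_assoc]

/-- Plain exchange of `C` through `φ_r` on `M_𝐢` (`i_r ≠ i_{r+1}`). [folklore] -/
theorem bkPhi_mul_bkTwistC_mul_of_mem_gen {r r' : Fin n} (h : (r' : ℕ) = r + 1)
    {χ : Fin n → k} (hc : χ r ≠ χ r') {w : MonoidAlgebra k (Perm (Fin n))}
    (hw : w ∈ jointEigenspace k χ) (b b' t : Fin n) (ψ : Fin n → k) (hct : ψ b ≠ ψ t) :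
    bkPhi k r r' * (bkTwistC k b b' t ψ * w) =
      bkTwistC k (swap r r' b) (swap r r' b') (swap r r' t) (ψ ∘ swap r r') * (bkPhi k r r' * w) := by
  have hc0 : ψ b - ψ t ≠ 0 := sub_ne_zero.2 hct
  have hK := bkPhi_mul_bkTwistK_mul_of_mem_gen k h hc hw b b' t ψ hct
  have hKM := mul_mem_jointEigenspace_of_mem_yAlg k (bkTwistK_mem_yAlg k b b' t ψ hct) hw
  have hPM : Ring.inverse (bkDiffUnit k b t (ψ b - ψ t)) * w ∈ jointEigenspace k χ :=
    mul_mem_jointEigenspace_of_mem_yAlg k (ringInverse_mem_yAlg k (bkDiffUnit_mem_yAlg k b t _)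
      (isUnit_bkDiffUnit k b t hc0)) hw
  have hK' := bkPhi_mul_bkTwistK_mul_of_mem_gen k h hc hPM b b' t ψ hct
  unfold bkTwistC
  simp only [Function.comp_apply, swap_apply_self]
  split_ifs
  · rw [neg_mul, mul_neg, hK, neg_mul]
  · rw [sub_mul, add_mul, mul_sub, mul_add, hK, mul_assoc _ _ w, mul_assoc _ _ w,
      bkPhi_mul_ringInverse_bkDiffUnit_mul_of_mem_gen k h hc hKM b' t hc0, hK, hK',
      bkPhi_mul_ringInverse_bkDiffUnit_mul_of_mem_gen k h hc hw b t hc0, sub_mul, add_mul,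
      mul_assoc, mul_assoc]
  · rw [zero_mul, mul_zero, zero_mul]
  · rw [neg_mul, mul_neg, hK, neg_mul]

/-- Plain exchange of `C'` through `φ_r` on `M_𝐢` (`i_r ≠ i_{r+1}`). [folklore] -/
theorem bkPhi_mul_bkTwistC'_mul_of_mem_gen {r r' : Fin n} (h : (r' : ℕ) = r + 1)
    {χ : Fin n → k} (hc : χ r ≠ χ r') {w : MonoidAlgebra k (Perm (Fin n))}
    (hw : w ∈ jointEigenspace k χ) (b b' t : Fin n) (ψ : Fin n → k) (hct : ψ b ≠ ψ t) :
    bkPhi k r r' * (bkTwistC' k b b' t ψ * w) =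
      bkTwistC' k (swap r r' b) (swap r r' b') (swap r r' t) (ψ ∘ swap r r') * (bkPhi k r r' * w) := by
  have hc0 : ψ b - ψ t ≠ 0 := sub_ne_zero.2 hct
  have hK := bkPhi_mul_bkTwistK_mul_of_mem_gen k h hc hw b b' t ψ hct
  have hKM := mul_mem_jointEigenspace_of_mem_yAlg k (bkTwistK_mem_yAlg k b b' t ψ hct) hw
  have hPM : Ring.inverse (bkDiffUnit k b t (ψ b - ψ t)) * w ∈ jointEigenspace k χ :=
    mul_mem_jointEigenspace_of_mem_yAlg k (ringInverse_mem_yAlg k (bkDiffUnit_mem_yAlg k b t _)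
      (isUnit_bkDiffUnit k b t hc0)) hw
  have hK' := bkPhi_mul_bkTwistK_mul_of_mem_gen k h hc hPM b b' t ψ hct
  unfold bkTwistC'
  simp only [Function.comp_apply, swap_apply_self]
  split_ifs
  · exact hK
  · rw [zero_mul, mul_zero, zero_mul]
  · rw [add_mul, add_mul, mul_add, mul_add, hK, mul_assoc _ _ w, mul_assoc _ _ w,
      bkPhi_mul_ringInverse_bkDiffUnit_mul_of_mem_gen k h hc hKM b' t hc0, hK, hK',
      bkPhi_mul_ringInverse_bkDiffUnit_mul_of_mem_gen k h hc hw b t hc0, add_mul, add_mul,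
      mul_assoc, mul_assoc]
  · exact hK

/-- (EI5) on `M_𝐢`, `i_r ≠ i_{r+1}`: `φ_r φ_r w = (1 - p_r(𝐢)²) w`. [folklore] -/
theorem bkPhi_mul_bkPhi_mul_of_mem_of_ne {r r' : Fin n} (h : (r' : ℕ) = r + 1)
    {χ : Fin n → k} (hc : χ r ≠ χ r') {w : MonoidAlgebra k (Perm (Fin n))}
    (hw : w ∈ jointEigenspace k χ) :
    bkPhi k r r' * (bkPhi k r r' * w) =
      (1 - Ring.inverse (bkDiffUnit k r r' (χ r - χ r')) *
        Ring.inverse (bkDiffUnit k r r' (χ r - χ r'))) * w := by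
  have he := bkPhi_mul_bkPhi_mul_klrIdempotent k h χ
  rw [if_neg hc] at he
  rw [← klrIdempotent_mul_of_mem k hw, ← mul_assoc, ← mul_assoc, he, mul_assoc, ← pow_two]

/-- (EI6), Case 4, on `M_𝐢`: `φ_rφ_{r+1}φ_r w = φ_{r+1}φ_rφ_{r+1} w + (u - v)(uv - u - v) w`,
`i_r = i_{r+2} ≠ i_{r+1}`. [folklore] -/
theorem bkPhi_braid_mul_of_mem_of_eq_of_ne {r r' r'' : Fin n} (h : (r' : ℕ) = r + 1)
    (h' : (r'' : ℕ) = r' + 1) {χ : Fin n → k} (h13 : χ r = χ r'') (h12 : χ r ≠ χ r')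
    {w : MonoidAlgebra k (Perm (Fin n))} (hw : w ∈ jointEigenspace k χ) :
    bkPhi k r r' * (bkPhi k r' r'' * (bkPhi k r r' * w)) =
      bkPhi k r' r'' * (bkPhi k r r' * (bkPhi k r' r'' * w)) +
        (Ring.inverse (bkDiffUnit k r r' (χ r - χ r')) -
            Ring.inverse (bkDiffUnit k r' r'' (χ r' - χ r''))) *
          (Ring.inverse (bkDiffUnit k r r' (χ r - χ r')) *
              Ring.inverse (bkDiffUnit k r' r'' (χ r' - χ r'')) -
            Ring.inverse (bkDiffUnit k r r' (χ r - χ r')) -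
            Ring.inverse (bkDiffUnit k r' r'' (χ r' - χ r''))) * w := by
  have he := bkPhi_braid_of_eq_of_ne k h h' h13 h12
  rw [← klrIdempotent_mul_of_mem k hw, ← mul_assoc, ← mul_assoc, ← mul_assoc, he]
  simp only [mul_assoc, add_mul]

end YAlg


/-! ### (R7), Case 4: `i_r = i_{r+2} ≠ i_{r+1}` -/

section BKCase4

open Equiv

variable (k : Type*) [Field k] [DecidableEq k] {n : ℕ}

/-- Case 4, the left-hand side: `ψ_1ψ_2ψ_1 e(iji) = φ_1φ_2φ_1 q_2^{-1} E^{-1} q_1^{-1} e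
- q'^{-1} C'ˢ q_2^{-1} (1 - p_1²) E^{-1} q_1^{-1} e` (`E = q_{(1,3)}`, `q' = q_{(2,1)}`,
`C'ˢ = bkTwistC' 1 3 2`; Brundan–Kleshchev p. 9, Case 4, first display, in element form). [folklore] -/
theorem bkPsi_triple_case4_lhs {r r' r'' : Fin n} (h : (r' : ℕ) = r + 1) (h' : (r'' : ℕ) = r' + 1)
    {χ : Fin n → k} (h13 : χ r = χ r'') (hij : χ r ≠ χ r') :
    bkPsi k r r' * bkPsi k r' r'' * bkPsi k r r' * klrIdempotent k χ =
      bkPhi k r r' * (bkPhi k r' r'' * (bkPhi k r r' *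
        (Ring.inverse (bkQ k r' r'' χ) * (Ring.inverse (bkQ k r r'' χ) *
          (Ring.inverse (bkQ k r r' χ) * klrIdempotent k χ))))) -
      Ring.inverse (bkQ k r' r χ) * (bkTwistC' k r r'' r' χ * (Ring.inverse (bkQ k r' r'' χ) *
        ((1 - Ring.inverse (bkDiffUnit k r r' (χ r - χ r')) *
            Ring.inverse (bkDiffUnit k r r' (χ r - χ r'))) *
          (Ring.inverse (bkQ k r r'' χ) * (Ring.inverse (bkQ k r r' χ) * klrIdempotent k χ))))) := by
  have hrr' : r ≠ r' := by intro e; rw [Fin.ext_iff] at e; omega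
  have hr'r'' : r' ≠ r'' := by intro e; rw [Fin.ext_iff] at e; omega
  have hrr'' : r ≠ r'' := by intro e; rw [Fin.ext_iff] at e; omega
  have hji : χ r' ≠ χ r := Ne.symm hij
  -- residue sequences met
  have hss : (χ ∘ swap r r') ∘ swap r r' = χ := by
    funext x; simp only [Function.comp_apply, swap_apply_self]
  have hfix1 : (χ ∘ swap r r') ∘ swap r' r'' = χ ∘ swap r r' := by
    funext x
    simp only [Function.comp_apply]
    by_cases e1 : x = r'
    · subst e1
      rw [swap_apply_left, swap_apply_right, swap_apply_of_ne_of_ne (Ne.symm hrr'') (Ne.symm hr'r''),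
        h13]
    by_cases e2 : x = r''
    · subst e2
      rw [swap_apply_right, swap_apply_right, swap_apply_of_ne_of_ne (Ne.symm hrr'') (Ne.symm hr'r''),
        h13]
    rw [swap_apply_of_ne_of_ne e1 e2]
  have h1r : (χ ∘ swap r r') r = χ r' := by simp [swap_apply_left]
  have h1r' : (χ ∘ swap r r') r' = χ r := by simp [swap_apply_right]
  have h1r'' : (χ ∘ swap r r') r'' = χ r'' := by
    simp [swap_apply_of_ne_of_ne (Ne.symm hrr'') (Ne.symm hr'r'')]
  -- memberships
  have hM : ∀ {z w : MonoidAlgebra k (Perm (Fin n))} {ψ : Fin n → k}, z ∈ yAlg k n →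
      w ∈ jointEigenspace k ψ → z * w ∈ jointEigenspace k ψ :=
    fun hz hw => mul_mem_jointEigenspace_of_mem_yAlg k hz hw
  have hιQ := ringInverse_bkQ_mem_yAlg k (n := n)
  have he := klrIdempotent_mem k χ
  have hv : Ring.inverse (bkQ k r r' χ) * klrIdempotent k χ ∈ jointEigenspace k χ := hM (hιQ _ _ _) he
  have hu : Ring.inverse (bkQ k r r'' χ) * (Ring.inverse (bkQ k r r' χ) * klrIdempotent k χ) ∈
      jointEigenspace k χ := hM (hιQ _ _ _) hv
  have hφv := bkPhi_mul_mem k h hv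
  have hφu := bkPhi_mul_mem k h hu
  have hφφu : bkPhi k r' r'' * (bkPhi k r r' * (Ring.inverse (bkQ k r r'' χ) *
      (Ring.inverse (bkQ k r r' χ) * klrIdempotent k χ))) ∈ jointEigenspace k (χ ∘ swap r r') := by
    have := bkPhi_mul_mem k h' hφu
    rwa [hfix1] at this
  -- Step 1–2: `ψ_2ψ_1 e = φ_2 φ_1 E⁻¹ q_1⁻¹ e`
  have hex1 := bkPhi_mul_ringInverse_bkQ_mul_of_mem_gen k h hij hv r r'' χ
  rw [swap_apply_left, swap_apply_of_ne_of_ne (Ne.symm hrr'') (Ne.symm hr'r'')] at hex1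
  -- Step 3–4: the twisted move through `φ_2` on `M_{s_1𝐢}`
  obtain ⟨-, hq₂⟩ := bkPhi_mul_bkQ_mul_of_mem_eq_first k h' (t := r) hrr' hrr''
    (χ := χ ∘ swap r r') (by rw [h1r', h1r'', h13]) (by rw [h1r', h1r]; exact hij)
  have hrule : ∀ w ∈ jointEigenspace k (χ ∘ swap r r'),
      bkPhi k r' r'' * (bkQ k r r'' (χ ∘ swap r r') * w) =
        bkQ k r r' (χ ∘ swap r r') * (bkPhi k r' r'' * w) +
          -bkTwistC' k r' r'' r (χ ∘ swap r r') * w := by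
    intro w hw; rw [hq₂ w hw, neg_mul, sub_eq_add_neg]
  have hinv := bkPhi_mul_ringInverse_mul_of_rule k hrule (isUnit_bkQ k _ _ _) (isUnit_bkQ k _ _ _)
    (fun w hw => hM (hιQ _ _ _) hw) hφu
  -- `ι(fs) φ₂ w₁ = φ₂ ι(f) w₁ - ι(fs) C' ι(f) w₁`
  have hmove : Ring.inverse (bkQ k r r' (χ ∘ swap r r')) * (bkPhi k r' r'' * (bkPhi k r r' *
      (Ring.inverse (bkQ k r r'' χ) * (Ring.inverse (bkQ k r r' χ) * klrIdempotent k χ)))) =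
      bkPhi k r' r'' * (Ring.inverse (bkQ k r r'' (χ ∘ swap r r')) * (bkPhi k r r' *
        (Ring.inverse (bkQ k r r'' χ) * (Ring.inverse (bkQ k r r' χ) * klrIdempotent k χ)))) -
      Ring.inverse (bkQ k r r' (χ ∘ swap r r')) * (bkTwistC' k r' r'' r (χ ∘ swap r r') *
        (Ring.inverse (bkQ k r r'' (χ ∘ swap r r')) * (bkPhi k r r' *
          (Ring.inverse (bkQ k r r'' χ) * (Ring.inverse (bkQ k r r' χ) * klrIdempotent k χ))))) := by
    rw [hinv, neg_mul, mul_neg, sub_neg_eq_add]; abel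
  -- Step 5: back through `φ_1` (plain exchanges) and `φ_1² = 1 - p²`
  have hex2 := bkPhi_mul_ringInverse_bkQ_mul_of_mem_gen k h hij hu r' r'' χ
  rw [swap_apply_right, swap_apply_of_ne_of_ne (Ne.symm hrr'') (Ne.symm hr'r'')] at hex2
  have hm3 : Ring.inverse (bkQ k r r'' (χ ∘ swap r r')) * (bkPhi k r r' *
      (Ring.inverse (bkQ k r r'' χ) * (Ring.inverse (bkQ k r r' χ) * klrIdempotent k χ))) ∈
      jointEigenspace k (χ ∘ swap r r') := hM (hιQ _ _ _) hφu
  have hm4 := hM (bkTwistC'_mem_yAlg k r' r'' r (χ ∘ swap r r') (by rw [h1r', h1r]; exact hij)) hm3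
  have hexA := bkPhi_mul_ringInverse_bkQ_mul_of_mem_gen k h (χ := χ ∘ swap r r')
    (by rw [h1r, h1r']; exact hji) hm4 r r' (χ ∘ swap r r')
  rw [swap_apply_left, swap_apply_right, hss] at hexA
  have hexB := bkPhi_mul_bkTwistC'_mul_of_mem_gen k h (χ := χ ∘ swap r r')
    (by rw [h1r, h1r']; exact hji) hm3 r' r'' r (χ ∘ swap r r') (by rw [h1r', h1r]; exact hij)
  rw [swap_apply_left, swap_apply_right, swap_apply_of_ne_of_ne (Ne.symm hrr'') (Ne.symm hr'r''),
    hss] at hexB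
  have hexC := bkPhi_mul_ringInverse_bkQ_mul_of_mem_gen k h (χ := χ ∘ swap r r')
    (by rw [h1r, h1r']; exact hji) hφu r r'' (χ ∘ swap r r')
  rw [swap_apply_left, swap_apply_of_ne_of_ne (Ne.symm hrr'') (Ne.symm hr'r''), hss] at hexC
  have hsq := bkPhi_mul_bkPhi_mul_of_mem_of_ne k h hij hu
  -- assemble
  rw [mul_assoc, mul_assoc, bkPsi_mul_of_mem k r r' he, bkPsi_mul_of_mem k r' r'' hφv, ← hex1,
    bkPsi_mul_of_mem k r r' hφφu, hmove, mul_sub, hex2,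
    -- the correction term: `φ₁ (ιfs (C' (ιf (φ₁ u)))) = ιq' (Cs' (ιq2 (φ₁ (φ₁ u))))`
    hexA, hexB, hexC, hsq]

/-- Case 4, the right-hand side: `ψ_2ψ_1ψ_2 e(iji) = φ_2φ_1φ_2 q_1^{-1} E^{-1} q_2^{-1} e
+ q''^{-1} Cˢ q_1^{-1} (1 - p_2²) E^{-1} q_2^{-1} e` (`q'' = q_{(3,2)}`, `Cˢ = bkTwistC 1 3 2`).
[folklore] -/
theorem bkPsi_triple_case4_rhs {r r' r'' : Fin n} (h : (r' : ℕ) = r + 1) (h' : (r'' : ℕ) = r' + 1)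
    {χ : Fin n → k} (h13 : χ r = χ r'') (hij : χ r ≠ χ r') :
    bkPsi k r' r'' * bkPsi k r r' * bkPsi k r' r'' * klrIdempotent k χ =
      bkPhi k r' r'' * (bkPhi k r r' * (bkPhi k r' r'' *
        (Ring.inverse (bkQ k r r' χ) * (Ring.inverse (bkQ k r r'' χ) *
          (Ring.inverse (bkQ k r' r'' χ) * klrIdempotent k χ))))) +
      Ring.inverse (bkQ k r'' r' χ) * (bkTwistC k r r'' r' χ * (Ring.inverse (bkQ k r r' χ) *
        ((1 - Ring.inverse (bkDiffUnit k r' r'' (χ r' - χ r'')) *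
            Ring.inverse (bkDiffUnit k r' r'' (χ r' - χ r''))) *
          (Ring.inverse (bkQ k r r'' χ) * (Ring.inverse (bkQ k r' r'' χ) * klrIdempotent k χ))))) := by
  have hrr' : r ≠ r' := by intro e; rw [Fin.ext_iff] at e; omega
  have hr'r'' : r' ≠ r'' := by intro e; rw [Fin.ext_iff] at e; omega
  have hrr'' : r ≠ r'' := by intro e; rw [Fin.ext_iff] at e; omega
  have hjk : χ r' ≠ χ r'' := fun e => hij (h13.trans e.symm)
  have hss : (χ ∘ swap r' r'') ∘ swap r' r'' = χ := by
    funext x; simp only [Function.comp_apply, swap_apply_self]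
  have hfix2 : (χ ∘ swap r' r'') ∘ swap r r' = χ ∘ swap r' r'' := by
    funext x
    simp only [Function.comp_apply]
    by_cases e1 : x = r
    · subst e1
      rw [swap_apply_left, swap_apply_left, swap_apply_of_ne_of_ne hrr' hrr'', h13]
    by_cases e2 : x = r'
    · subst e2
      rw [swap_apply_right, swap_apply_left, swap_apply_of_ne_of_ne hrr' hrr'', h13]
    rw [swap_apply_of_ne_of_ne e1 e2]
  have h2r : (χ ∘ swap r' r'') r = χ r := by simp [swap_apply_of_ne_of_ne hrr' hrr'']
  have h2r' : (χ ∘ swap r' r'') r' = χ r'' := by simp [swap_apply_left]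
  have h2r'' : (χ ∘ swap r' r'') r'' = χ r' := by simp [swap_apply_right]
  have hM : ∀ {z w : MonoidAlgebra k (Perm (Fin n))} {ψ : Fin n → k}, z ∈ yAlg k n →
      w ∈ jointEigenspace k ψ → z * w ∈ jointEigenspace k ψ :=
    fun hz hw => mul_mem_jointEigenspace_of_mem_yAlg k hz hw
  have hιQ := ringInverse_bkQ_mem_yAlg k (n := n)
  have he := klrIdempotent_mem k χ
  have hv : Ring.inverse (bkQ k r' r'' χ) * klrIdempotent k χ ∈ jointEigenspace k χ := hM (hιQ _ _ _) he
  have hu : Ring.inverse (bkQ k r r'' χ) * (Ring.inverse (bkQ k r' r'' χ) * klrIdempotent k χ) ∈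
      jointEigenspace k χ := hM (hιQ _ _ _) hv
  have hφv := bkPhi_mul_mem k h' hv
  have hφu := bkPhi_mul_mem k h' hu
  have hφφu : bkPhi k r r' * (bkPhi k r' r'' * (Ring.inverse (bkQ k r r'' χ) *
      (Ring.inverse (bkQ k r' r'' χ) * klrIdempotent k χ))) ∈ jointEigenspace k (χ ∘ swap r' r'') := by
    have := bkPhi_mul_mem k h hφu
    rwa [hfix2] at this
  have hex3 := bkPhi_mul_ringInverse_bkQ_mul_of_mem_gen k h' hjk hv r r'' χ
  rw [swap_apply_of_ne_of_ne hrr' hrr'', swap_apply_right] at hex3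
  obtain ⟨hT, -⟩ := bkPhi_mul_bkQ_mul_of_mem_eq_last k h (t := r'') (Ne.symm hrr'') (Ne.symm hr'r'')
    (χ := χ ∘ swap r' r'') (by rw [h2r, h2r', h13]) (by rw [h2r, h2r'']; exact hij)
  have hinv := bkPhi_mul_ringInverse_mul_of_rule k hT (isUnit_bkQ k _ _ _) (isUnit_bkQ k _ _ _)
    (fun w hw => hM (hιQ _ _ _) hw) hφu
  have hmove : Ring.inverse (bkQ k r' r'' (χ ∘ swap r' r'')) * (bkPhi k r r' * (bkPhi k r' r'' *
      (Ring.inverse (bkQ k r r'' χ) * (Ring.inverse (bkQ k r' r'' χ) * klrIdempotent k χ)))) =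
      bkPhi k r r' * (Ring.inverse (bkQ k r r'' (χ ∘ swap r' r'')) * (bkPhi k r' r'' *
        (Ring.inverse (bkQ k r r'' χ) * (Ring.inverse (bkQ k r' r'' χ) * klrIdempotent k χ)))) +
      Ring.inverse (bkQ k r' r'' (χ ∘ swap r' r'')) * (bkTwistC k r r' r'' (χ ∘ swap r' r'') *
        (Ring.inverse (bkQ k r r'' (χ ∘ swap r' r'')) * (bkPhi k r' r'' *
          (Ring.inverse (bkQ k r r'' χ) * (Ring.inverse (bkQ k r' r'' χ) * klrIdempotent k χ))))) := by
    rw [hinv]; abel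
  have hex4 := bkPhi_mul_ringInverse_bkQ_mul_of_mem_gen k h' hjk hu r r' χ
  rw [swap_apply_of_ne_of_ne hrr' hrr'', swap_apply_left] at hex4
  have hm3 : Ring.inverse (bkQ k r r'' (χ ∘ swap r' r'')) * (bkPhi k r' r'' *
      (Ring.inverse (bkQ k r r'' χ) * (Ring.inverse (bkQ k r' r'' χ) * klrIdempotent k χ))) ∈
      jointEigenspace k (χ ∘ swap r' r'') := hM (hιQ _ _ _) hφu
  have hm4 := hM (bkTwistC_mem_yAlg k r r' r'' (χ ∘ swap r' r'') (by rw [h2r, h2r'']; exact hij)) hm3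
  have hexA := bkPhi_mul_ringInverse_bkQ_mul_of_mem_gen k h' (χ := χ ∘ swap r' r'')
    (by rw [h2r', h2r'']; exact hjk.symm) hm4 r' r'' (χ ∘ swap r' r'')
  rw [swap_apply_left, swap_apply_right, hss] at hexA
  have hexB := bkPhi_mul_bkTwistC_mul_of_mem_gen k h' (χ := χ ∘ swap r' r'')
    (by rw [h2r', h2r'']; exact hjk.symm) hm3 r r' r'' (χ ∘ swap r' r'') (by rw [h2r, h2r'']; exact hij)
  rw [swap_apply_left, swap_apply_right, swap_apply_of_ne_of_ne hrr' hrr'', hss] at hexB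
  have hexC := bkPhi_mul_ringInverse_bkQ_mul_of_mem_gen k h' (χ := χ ∘ swap r' r'')
    (by rw [h2r', h2r'']; exact hjk.symm) hφu r r'' (χ ∘ swap r' r'')
  rw [swap_apply_of_ne_of_ne hrr' hrr'', swap_apply_right, hss] at hexC
  have hsq := bkPhi_mul_bkPhi_mul_of_mem_of_ne k h' hjk hu
  rw [mul_assoc, mul_assoc, bkPsi_mul_of_mem k r' r'' he, bkPsi_mul_of_mem k r r' hφv, ← hex3,
    bkPsi_mul_of_mem k r' r'' hφφu, hmove, mul_add, hex4, hexA, hexB, hexC, hsq]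


open scoped IsMulCommutative in
/-- The scalar identity behind (R7), Case 4 (Brundan–Kleshchev p. 9–10: `A + B - C`), in the
commutative algebra `Y''`, by the four quiver cases. [folklore] -/
theorem bkCase4_scalar {r r' r'' : Fin n} {χ : Fin n → k} (h13 : χ r = χ r'') (hij : χ r ≠ χ r') :
    (Ring.inverse (bkDiffUnit k r r' (χ r - χ r')) - Ring.inverse (bkDiffUnit k r' r'' (χ r' - χ r''))) *
        (Ring.inverse (bkDiffUnit k r r' (χ r - χ r')) * Ring.inverse (bkDiffUnit k r' r'' (χ r' - χ r'')) -
          Ring.inverse (bkDiffUnit k r r' (χ r - χ r')) - Ring.inverse (bkDiffUnit k r' r'' (χ r' - χ r''))) *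
        Ring.inverse (bkQ k r' r'' χ) * Ring.inverse (bkQ k r r'' χ) * Ring.inverse (bkQ k r r' χ) -
      Ring.inverse (bkQ k r' r χ) * bkTwistC' k r r'' r' χ * Ring.inverse (bkQ k r' r'' χ) *
        (1 - Ring.inverse (bkDiffUnit k r r' (χ r - χ r')) * Ring.inverse (bkDiffUnit k r r' (χ r - χ r'))) *
        Ring.inverse (bkQ k r r'' χ) * Ring.inverse (bkQ k r r' χ) =
    Ring.inverse (bkQ k r'' r' χ) * bkTwistC k r r'' r' χ * Ring.inverse (bkQ k r r' χ) *
        (1 - Ring.inverse (bkDiffUnit k r' r'' (χ r' - χ r'')) * Ring.inverse (bkDiffUnit k r' r'' (χ r' - χ r''))) *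
        Ring.inverse (bkQ k r r'' χ) * Ring.inverse (bkQ k r' r'' χ) +
      (if χ r' = χ r + 1 then
          (if χ r = χ r' + 1 then bkNilpotent k r - 2 * bkNilpotent k r' + bkNilpotent k r''
            else (1 : MonoidAlgebra k (Perm (Fin n))))
        else (if χ r = χ r' + 1 then (-1 : MonoidAlgebra k (Perm (Fin n))) else 0)) := by
  have hjk : χ r' ≠ χ r'' := fun e => hij (h13.trans e.symm)
  have hji : χ r' ≠ χ r := Ne.symm hij
  have hkj : χ r'' ≠ χ r' := Ne.symm hjk
  have hua : IsUnit (bkDiffUnit k r r' (χ r - χ r')) := isUnit_bkDiffUnit k r r' (sub_ne_zero.2 hij)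
  have hub : IsUnit (bkDiffUnit k r' r'' (χ r' - χ r'')) := isUnit_bkDiffUnit k r' r'' (sub_ne_zero.2 hjk)
  -- the stray inverse `ι(D(3,2,c)) = -b` and `K = -b E a`
  have hD32 : Ring.inverse (bkDiffUnit k r'' r' (χ r - χ r')) =
      -Ring.inverse (bkDiffUnit k r' r'' (χ r' - χ r'')) := by
    rw [bkDiffUnit_swap, show -(χ r - χ r') = χ r' - χ r'' by rw [h13]; ring, ringInverse_neg hub]
  have hK : bkTwistK k r r'' r' χ = -Ring.inverse (bkDiffUnit k r' r'' (χ r' - χ r'')) *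
      bkQ k r r'' χ * Ring.inverse (bkDiffUnit k r r' (χ r - χ r')) := by
    rw [bkTwistK, hD32]
  have hE : bkQ k r r'' χ = 1 + (bkNilpotent k r'' - bkNilpotent k r) := by rw [bkQ, if_pos h13]
  have hPa : bkP k r r' χ = Ring.inverse (bkDiffUnit k r r' (χ r - χ r')) := by rw [bkP, if_neg hij]
  have hPb : bkP k r' r'' χ = Ring.inverse (bkDiffUnit k r' r'' (χ r' - χ r'')) := by rw [bkP, if_neg hjk]
  have hPa' : bkP k r' r χ = -Ring.inverse (bkDiffUnit k r r' (χ r - χ r')) := bkP_swap k hij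
  have hPb' : bkP k r'' r' χ = -Ring.inverse (bkDiffUnit k r' r'' (χ r' - χ r'')) := bkP_swap k hjk
  -- atoms of `Y''`
  obtain ⟨a, ha⟩ : ∃ a : yAlg k n, (a : MonoidAlgebra k (Perm (Fin n))) =
      Ring.inverse (bkDiffUnit k r r' (χ r - χ r')) :=
    ⟨⟨_, ringInverse_mem_yAlg k (bkDiffUnit_mem_yAlg k _ _ _) hua⟩, rfl⟩
  obtain ⟨b, hb⟩ : ∃ b : yAlg k n, (b : MonoidAlgebra k (Perm (Fin n))) =
      Ring.inverse (bkDiffUnit k r' r'' (χ r' - χ r'')) :=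
    ⟨⟨_, ringInverse_mem_yAlg k (bkDiffUnit_mem_yAlg k _ _ _) hub⟩, rfl⟩
  obtain ⟨E, hEa⟩ : ∃ E : yAlg k n, (E : MonoidAlgebra k (Perm (Fin n))) = bkQ k r r'' χ :=
    ⟨⟨_, bkQ_mem_yAlg k _ _ _⟩, rfl⟩
  obtain ⟨e, he⟩ : ∃ e : yAlg k n, (e : MonoidAlgebra k (Perm (Fin n))) = Ring.inverse (bkQ k r r'' χ) :=
    ⟨⟨_, ringInverse_bkQ_mem_yAlg k _ _ _⟩, rfl⟩
  obtain ⟨u1, hu1⟩ : ∃ u : yAlg k n, (u : MonoidAlgebra k (Perm (Fin n))) = Ring.inverse (bkQ k r r' χ) :=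
    ⟨⟨_, ringInverse_bkQ_mem_yAlg k _ _ _⟩, rfl⟩
  obtain ⟨u2, hu2⟩ : ∃ u : yAlg k n, (u : MonoidAlgebra k (Perm (Fin n))) = Ring.inverse (bkQ k r' r'' χ) :=
    ⟨⟨_, ringInverse_bkQ_mem_yAlg k _ _ _⟩, rfl⟩
  obtain ⟨u3, hu3⟩ : ∃ u : yAlg k n, (u : MonoidAlgebra k (Perm (Fin n))) = Ring.inverse (bkQ k r' r χ) :=
    ⟨⟨_, ringInverse_bkQ_mem_yAlg k _ _ _⟩, rfl⟩
  obtain ⟨u4, hu4⟩ : ∃ u : yAlg k n, (u : MonoidAlgebra k (Perm (Fin n))) = Ring.inverse (bkQ k r'' r' χ) :=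
    ⟨⟨_, ringInverse_bkQ_mem_yAlg k _ _ _⟩, rfl⟩
  obtain ⟨Y1, hY1⟩ : ∃ Y : yAlg k n, (Y : MonoidAlgebra k (Perm (Fin n))) = bkNilpotent k r :=
    ⟨⟨_, bkNilpotent_mem_yAlg k _⟩, rfl⟩
  obtain ⟨Y2, hY2⟩ : ∃ Y : yAlg k n, (Y : MonoidAlgebra k (Perm (Fin n))) = bkNilpotent k r' :=
    ⟨⟨_, bkNilpotent_mem_yAlg k _⟩, rfl⟩
  obtain ⟨Y3, hY3⟩ : ∃ Y : yAlg k n, (Y : MonoidAlgebra k (Perm (Fin n))) = bkNilpotent k r'' :=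
    ⟨⟨_, bkNilpotent_mem_yAlg k _⟩, rfl⟩
  -- relations, common part
  have Re : (e : MonoidAlgebra k (Perm (Fin n))) * E = 1 := by
    rw [he, hEa]; exact Ring.inverse_mul_cancel _ (isUnit_bkQ k _ _ _)
  have RE : (E : MonoidAlgebra k (Perm (Fin n))) = 1 + (Y3 - Y1) := by rw [hEa, hE, hY1, hY3]
  have Re' : e * E = 1 := by exact_mod_cast Re
  have RE' : E = 1 + (Y3 - Y1) := by exact_mod_cast RE
  have R1 := Ring.inverse_mul_cancel _ (isUnit_bkQ k r r' χ)
  have R2 := Ring.inverse_mul_cancel _ (isUnit_bkQ k r' r'' χ)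
  have R3 := Ring.inverse_mul_cancel _ (isUnit_bkQ k r' r χ)
  have R4 := Ring.inverse_mul_cancel _ (isUnit_bkQ k r'' r' χ)
  have Ra := Ring.inverse_mul_cancel _ hua
  have Rb := Ring.inverse_mul_cancel _ hub
  rw [← hu1, bkQ, if_neg hij, hPa, ← ha] at R1
  rw [← hu2, bkQ, if_neg hjk, hPb, ← hb] at R2
  rw [← hu3, bkQ, if_neg hji, hPa', ← ha] at R3
  rw [← hu4, bkQ, if_neg hkj, hPb', ← hb] at R4
  rw [← ha, bkDiffUnit, ← hY1, ← hY2] at Ra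
  rw [← hb, bkDiffUnit, ← hY2, ← hY3] at Rb
  -- rewrite the goal in terms of the atoms
  rw [bkTwistC', bkTwistC, hK, hD32, ← he, ← hu1, ← hu2, ← hu3, ← hu4, ← ha, ← hb, ← hEa]
  by_cases h1 : χ r' = χ r + 1 <;> by_cases h2 : χ r = χ r' + 1
  · -- `i ⇄ j` (characteristic 2): `q₁ = -a`, `q₂ = -b`, `q' = a`, `q'' = b`, `C' = K`, `C = -K`
    have h2k : (2 : k) = 0 := by linear_combination -h1 - h2
    have h2S : (2 : yAlg k n) = 0 := by
      have := congrArg (algebraMap k (yAlg k n)) h2k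
      rwa [map_ofNat, map_zero] at this
    simp only [if_pos h1, if_pos h2]
    rw [← hY1, ← hY2, ← hY3, two_mul]
    rw [if_pos h1, if_pos h2] at R1
    rw [← h13, if_pos h2, if_pos h1] at R2
    rw [if_pos h2, if_pos h1, neg_neg] at R3
    rw [← h13, if_pos h1, if_pos h2, neg_neg] at R4
    rw [show χ r - χ r' = 1 by rw [h2]; ring, map_one] at Ra
    rw [show χ r' - χ r'' = 1 by rw [← h13, h1]; ring, map_one] at Rb
    have R1' : u1 * -a = 1 := by exact_mod_cast R1
    have R2' : u2 * -b = 1 := by exact_mod_cast R2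
    have R3' : u3 * a = 1 := by exact_mod_cast R3
    have R4' : u4 * b = 1 := by exact_mod_cast R4
    have Ra' : a * (1 + (Y1 - Y2)) = 1 := by exact_mod_cast Ra
    have Rb' : b * (1 + (Y2 - Y3)) = 1 := by exact_mod_cast Rb
    exact_mod_cast (show (a - b) * (a * b - a - b) * u2 * e * u1 -
        u3 * (-b * E * a) * u2 * (1 - a * a) * e * u1 =
        u4 * -(-b * E * a) * u1 * (1 - b * b) * e * u2 + (Y1 - (Y2 + Y2) + Y3) by
      linear_combination (((1 + (Y1 - Y2)) - (1 + (Y2 - Y3))) * (u1 * -a) * (u2 * -b)) * Re' +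
        (((1 + (Y1 - Y2)) - (1 + (Y2 - Y3))) * (u2 * -b)) * R1' +
        ((1 + (Y1 - Y2)) - (1 + (Y2 - Y3))) * R2' - (e * u1 * u2 * a * b * (a - b)) * h2S +
        (e * u1 * u2 * (a - b) * b - e * u1 * u2 * a * b * E * u3) * Ra' +
        (e * u1 * u2 * (a - b) * a + e * u1 * u2 * a * b * E * u4) * Rb' +
        (e * u1 * u2 * a * b * E * ((1 + (Y1 - Y2)) - a)) * R3' -
        (e * u1 * u2 * a * b * E * ((1 + (Y2 - Y3)) - b)) * R4' +
        (-a ^ 2 * b * e * u1 * u2 + a * b ^ 2 * e * u1 * u2) * RE')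
  · -- `i → j`: `q₁ = a² - a`, `q₂ = 1`, `q' = 1`, `q'' = b² + b`, `C' = 0`, `C = -bK + Ka - K`
    simp only [if_pos h1, if_neg h2]
    rw [if_pos h1, if_neg h2] at R1
    rw [← h13, if_neg h2, if_pos h1] at R2
    rw [if_neg h2, if_pos h1] at R3
    rw [← h13, if_pos h1, if_neg h2, neg_mul_neg, sub_neg_eq_add] at R4
    rw [show χ r - χ r' = -1 by rw [h1]; ring, map_neg, map_one] at Ra
    rw [show χ r' - χ r'' = 1 by rw [← h13, h1]; ring, map_one] at Rb
    have R1' : u1 * (a * a - a) = 1 := by exact_mod_cast R1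
    have R2' : u2 * 1 = 1 := by exact_mod_cast R2
    have R4' : u4 * (b * b + b) = 1 := by exact_mod_cast R4
    have Ra' : a * (-1 + (Y1 - Y2)) = 1 := by exact_mod_cast Ra
    have Rb' : b * (1 + (Y2 - Y3)) = 1 := by exact_mod_cast Rb
    exact_mod_cast (show (a - b) * (a * b - a - b) * u2 * e * u1 - u3 * 0 * u2 * (1 - a * a) * e * u1 =
        u4 * (-b * (-b * E * a) + -b * E * a * a - -b * E * a) * u1 * (1 - b * b) * e * u2 + 1 by
      linear_combination R1' + (u1 * (a * a - a)) * Re' + (u1 * e * (a - b) * b) * Ra' +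
        (u1 * e * (a - b) * a) * Rb' + (u1 * e * (a - b - 1) * (1 - b) * a * E) * R4' +
        (-E * a ^ 2 * b ^ 3 * e * u1 * u4 + E * a ^ 2 * b * e * u1 * u4 + E * a * b ^ 4 * e * u1 * u4 +
          E * a * b ^ 3 * e * u1 * u4 - E * a * b ^ 2 * e * u1 * u4 - E * a * b * e * u1 * u4 +
          a ^ 2 * b * e * u1 - a ^ 2 * e * u1 - a * b ^ 2 * e * u1 + b ^ 2 * e * u1) * R2' +
        (-a ^ 2 * b * e * u1 + a * b ^ 2 * e * u1) * RE')
  · -- `i ← j`: `q₁ = 1`, `q₂ = b² - b`, `q' = a² + a`, `q'' = 1`, `C' = -bK + Ka + K`, `C = 0`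
    simp only [if_neg h1, if_pos h2]
    rw [if_neg h1, if_pos h2] at R1
    rw [← h13, if_pos h2, if_neg h1] at R2
    rw [if_pos h2, if_neg h1, neg_mul_neg, sub_neg_eq_add] at R3
    rw [← h13, if_neg h1, if_pos h2] at R4
    rw [show χ r - χ r' = 1 by rw [h2]; ring, map_one] at Ra
    rw [show χ r' - χ r'' = -1 by rw [← h13, h2]; ring, map_neg, map_one] at Rb
    have R1' : u1 * 1 = 1 := by exact_mod_cast R1
    have R2' : u2 * (b * b - b) = 1 := by exact_mod_cast R2
    have R3' : u3 * (a * a + a) = 1 := by exact_mod_cast R3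
    have Ra' : a * (1 + (Y1 - Y2)) = 1 := by exact_mod_cast Ra
    have Rb' : b * (-1 + (Y2 - Y3)) = 1 := by exact_mod_cast Rb
    exact_mod_cast (show (a - b) * (a * b - a - b) * u2 * e * u1 -
        u3 * (-b * (-b * E * a) + -b * E * a * a + -b * E * a) * u2 * (1 - a * a) * e * u1 =
        u4 * 0 * u1 * (1 - b * b) * e * u2 + -1 by
      linear_combination -R2' - (u2 * (b * b - b)) * Re' + (u2 * e * (a - b) * b) * Ra' +
        (u2 * e * (a - b) * a) * Rb' + (u2 * e * (a - b + 1) * (1 - a) * b * E) * R3' +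
        (-E * a ^ 4 * b * e * u2 * u3 + E * a ^ 3 * b ^ 2 * e * u2 * u3 - E * a ^ 3 * b * e * u2 * u3 +
          E * a ^ 2 * b * e * u2 * u3 - E * a * b ^ 2 * e * u2 * u3 + E * a * b * e * u2 * u3 +
          a ^ 2 * b * e * u2 - a ^ 2 * e * u2 - a * b ^ 2 * e * u2 + b ^ 2 * e * u2) * R1' +
        (-a ^ 2 * b * e * u2 + a * b ^ 2 * e * u2) * RE')
  · -- unrelated: `q₁ = 1 - a`, `q₂ = 1 - b`, `q' = 1 + a`, `q'' = 1 + b`, `C' = K`, `C = -K`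
    simp only [if_neg h1, if_neg h2]
    rw [if_neg h1, if_neg h2] at R1
    rw [← h13, if_neg h2, if_neg h1] at R2
    rw [if_neg h2, if_neg h1, sub_neg_eq_add] at R3
    rw [← h13, if_neg h1, if_neg h2, sub_neg_eq_add] at R4
    obtain ⟨κ, hκ⟩ : ∃ κ : yAlg k n, (κ : MonoidAlgebra k (Perm (Fin n))) =
        algebraMap k (MonoidAlgebra k (Perm (Fin n))) (χ r - χ r') := ⟨algebraMap k (yAlg k n) _, rfl⟩
    rw [show χ r' - χ r'' = -(χ r - χ r') by rw [h13]; ring, map_neg, ← hκ] at Rb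
    rw [← hκ] at Ra
    have R1' : u1 * (1 - a) = 1 := by exact_mod_cast R1
    have R2' : u2 * (1 - b) = 1 := by exact_mod_cast R2
    have R3' : u3 * (1 + a) = 1 := by exact_mod_cast R3
    have R4' : u4 * (1 + b) = 1 := by exact_mod_cast R4
    have Ra' : a * (κ + (Y1 - Y2)) = 1 := by exact_mod_cast Ra
    have Rb' : b * (-κ + (Y2 - Y3)) = 1 := by exact_mod_cast Rb
    exact_mod_cast (show (a - b) * (a * b - a - b) * u2 * e * u1 -
        u3 * (-b * E * a) * u2 * (1 - a * a) * e * u1 =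
        u4 * -(-b * E * a) * u1 * (1 - b * b) * e * u2 + 0 by
      linear_combination (e * u1 * u2 * a * b * E * (1 - a)) * R3' - (e * u1 * u2 * a * b * E * (1 - b)) * R4' +
        (e * u1 * u2 * (a - b) * b) * Ra' + (e * u1 * u2 * (a - b) * a) * Rb' +
        (-a ^ 2 * b * e * u1 * u2 + a * b ^ 2 * e * u1 * u2) * RE')

/-- **(R7) of Brundan–Kleshchev's Theorem 3.2, Case 4 (`i_r = i_{r+2} ≠ i_{r+1}`):
`ψ_rψ_{r+1}ψ_r e(𝐢) = ψ_{r+1}ψ_rψ_{r+1} e(𝐢) + c · e(𝐢)` with `c = 1` if `i_r → i_{r+1}`, `c = -1`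
if `i_r ← i_{r+1}`, `c = y_r - 2y_{r+1} + y_{r+2}` if `i_r ⇄ i_{r+1}`, `c = 0` otherwise**
(arXiv:0808.2032, Thm 3.2 (R7) and pp. 9–10 of its proof; cited through [HuMathas2010, Thm 24]).
[folklore] -/
theorem bkPsi_braid_of_eq_of_ne {r r' r'' : Fin n} (h : (r' : ℕ) = r + 1) (h' : (r'' : ℕ) = r' + 1)
    {χ : Fin n → k} (h13 : χ r = χ r'') (hij : χ r ≠ χ r') :
    bkPsi k r r' * bkPsi k r' r'' * bkPsi k r r' * klrIdempotent k χ =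
      bkPsi k r' r'' * bkPsi k r r' * bkPsi k r' r'' * klrIdempotent k χ +
        (if χ r' = χ r + 1 then
            (if χ r = χ r' + 1 then bkNilpotent k r - 2 * bkNilpotent k r' + bkNilpotent k r''
              else (1 : MonoidAlgebra k (Perm (Fin n))))
          else (if χ r = χ r' + 1 then (-1 : MonoidAlgebra k (Perm (Fin n))) else 0)) *
          klrIdempotent k χ := by
  have hM : ∀ {z w : MonoidAlgebra k (Perm (Fin n))} {ψ : Fin n → k}, z ∈ yAlg k n →
      w ∈ jointEigenspace k ψ → z * w ∈ jointEigenspace k ψ :=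
    fun hz hw => mul_mem_jointEigenspace_of_mem_yAlg k hz hw
  have hιQ := ringInverse_bkQ_mem_yAlg k (n := n)
  have cQ : ∀ x x' z z' : Fin n, Commute (Ring.inverse (bkQ k x x' χ)) (Ring.inverse (bkQ k z z' χ)) :=
    fun x x' z z' => (commute_bkQ k (fun t => (commute_bkQ k (commute_bkNilpotent k t) x x' χ).symm)
      z z' χ).ringInverse_ringInverse
  have hre : Ring.inverse (bkQ k r r' χ) * (Ring.inverse (bkQ k r r'' χ) *
      (Ring.inverse (bkQ k r' r'' χ) * klrIdempotent k χ)) =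
      Ring.inverse (bkQ k r' r'' χ) * (Ring.inverse (bkQ k r r'' χ) *
        (Ring.inverse (bkQ k r r' χ) * klrIdempotent k χ)) := by
    rw [(cQ r r'' r' r'').left_comm, (cQ r r' r' r'').left_comm, (cQ r r' r r'').left_comm]
  have hw : Ring.inverse (bkQ k r' r'' χ) * (Ring.inverse (bkQ k r r'' χ) *
      (Ring.inverse (bkQ k r r' χ) * klrIdempotent k χ)) ∈ jointEigenspace k χ :=
    hM (hιQ _ _ _) (hM (hιQ _ _ _) (hM (hιQ _ _ _) (klrIdempotent_mem k χ)))
  have key := congrArg (· * klrIdempotent k χ) (bkCase4_scalar k h13 hij)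
  rw [sub_mul, add_mul] at key
  rw [bkPsi_triple_case4_lhs k h h' h13 hij, bkPsi_triple_case4_rhs k h h' h13 hij, hre,
    bkPhi_braid_mul_of_mem_of_eq_of_ne k h h' h13 hij hw, add_sub_assoc, add_assoc, add_right_inj]
  simp only [mul_assoc] at key ⊢
  exact key

end BKCase4


/-! ### (R7), Case 5: `i_r = i_{r+1} = i_{r+2}` — the nil-Hecke case

On `M_𝐢` with equal residues `φ_r = s_r + 1` and `ψ_r = (s_r + 1) q_r(𝐢)^{-1} = q̄_r^{-1}(s_r - 1)`
with `q̄_r = 1 + y_r - y_{r+1}` (Brundan–Kleshchev leave this case "as an exercise"; in the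
polynomial picture `ψ_r` is minus a Demazure operator). We compute both sides of the braid
relation as `F · (s-words) + scalar · (s_r - 1)` and compare. -/

section BKCase5

open Equiv

variable (k : Type*) [Field k] [DecidableEq k] {n : ℕ}

/-- `y_t w = L_t w - i_t • w` on `M_𝐢`. [folklore] -/
theorem bkNilpotent_mul_of_mem (t : Fin n) {χ : Fin n → k} {w : MonoidAlgebra k (Perm (Fin n))}
    (hw : w ∈ jointEigenspace k χ) : bkNilpotent k t * w = jucysMurphy k t * w - χ t • w := by
  have ht : bkNilpotent k t = jucysMurphy k t - ∑ ψ ∈ residueSeqs k n, ψ t • klrIdempotent k ψ :=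
    eq_sub_of_add_eq (jucysMurphy_eq_bkNilpotent_add k t).symm
  rw [ht, sub_mul, sum_smul_klrIdempotent_mul_of_mem k t hw]

/-- **`s_r y_r w = y_{r+1} s_r w - w` on `M_𝐢` for `i_r = i_{r+1}`** (the degenerate affine Hecke
relation `s_r x_r = x_{r+1} s_r - 1` on an equal-residue block). [folklore] -/
theorem of_swap_mul_bkNilpotent_mul_of_mem_eq {r r' : Fin n} (h : (r' : ℕ) = r + 1)
    {χ : Fin n → k} (hc : χ r = χ r') {w : MonoidAlgebra k (Perm (Fin n))}
    (hw : w ∈ jointEigenspace k χ) :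
    MonoidAlgebra.of k _ (swap r r') * (bkNilpotent k r * w) =
      bkNilpotent k r' * (MonoidAlgebra.of k _ (swap r r') * w) - w := by
  have hsw := of_swap_mul_mem_of_eq k h hc hw
  have hsL : MonoidAlgebra.of k _ (swap r r') * jucysMurphy k r =
      jucysMurphy k r' * MonoidAlgebra.of k _ (swap r r') - 1 :=
    eq_sub_of_add_eq (jucysMurphy_succ_mul_swap k h).symm
  rw [bkNilpotent_mul_of_mem k r hw, mul_sub, mul_smul_comm, ← mul_assoc, hsL, sub_mul, one_mul,
    mul_assoc, bkNilpotent_mul_of_mem k r' hsw, hc]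
  abel

/-- **`s_r y_{r+1} w = y_r s_r w + w` on `M_𝐢` for `i_r = i_{r+1}`.** [folklore] -/
theorem of_swap_mul_bkNilpotent_succ_mul_of_mem_eq {r r' : Fin n} (h : (r' : ℕ) = r + 1)
    {χ : Fin n → k} (hc : χ r = χ r') {w : MonoidAlgebra k (Perm (Fin n))}
    (hw : w ∈ jointEigenspace k χ) :
    MonoidAlgebra.of k _ (swap r r') * (bkNilpotent k r' * w) =
      bkNilpotent k r * (MonoidAlgebra.of k _ (swap r r') * w) + w := by
  have hsw := of_swap_mul_mem_of_eq k h hc hw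
  rw [bkNilpotent_mul_of_mem k r' hw, mul_sub, mul_smul_comm, ← mul_assoc,
    of_swap_mul_jucysMurphy_succ k h, add_mul, one_mul, mul_assoc, bkNilpotent_mul_of_mem k r hsw, hc]
  abel

omit [DecidableEq k] in
/-- Inverting a twisted rule for an arbitrary operator `T`: if `T f w = f' T w + C w` on `M_𝐢` then
`T f^{-1} w = f'^{-1} T w - f'^{-1} C f^{-1} w`. [folklore] -/
theorem op_mul_ringInverse_mul_of_rule {χ : Fin n → k} {T f fs C : MonoidAlgebra k (Perm (Fin n))}
    (hf : ∀ w ∈ jointEigenspace k χ, T * (f * w) = fs * (T * w) + C * w)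
    (hu : IsUnit f) (hus : IsUnit fs)
    (hfM : ∀ w ∈ jointEigenspace k χ, Ring.inverse f * w ∈ jointEigenspace k χ)
    {w : MonoidAlgebra k (Perm (Fin n))} (hw : w ∈ jointEigenspace k χ) :
    T * (Ring.inverse f * w) = Ring.inverse fs * (T * w) - Ring.inverse fs * (C * (Ring.inverse f * w)) := by
  have key := hf _ (hfM w hw)
  rw [← mul_assoc f, Ring.mul_inverse_cancel _ hu, one_mul] at key
  have key' : fs * (T * (Ring.inverse f * w)) = T * w - C * (Ring.inverse f * w) :=
    eq_sub_of_add_eq key.symm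
  calc T * (Ring.inverse f * w) = Ring.inverse fs * (fs * (T * (Ring.inverse f * w))) := by
        rw [← mul_assoc (Ring.inverse fs), Ring.inverse_mul_cancel _ hus, one_mul]
    _ = _ := by rw [key', mul_sub]

/-- `q_{(a,b)}(𝐢) = 1 + (y_b - y_a)` when `i_a = i_b`. [folklore] -/
theorem bkQ_of_eq {a b : Fin n} {χ : Fin n → k} (h : χ a = χ b) :
    bkQ k a b χ = 1 + (bkNilpotent k b - bkNilpotent k a) := by rw [bkQ, if_pos h]

/-- **`s_r q_r w = q̄_r s_r w + 2 w`** on `M_𝐢` (`i_r = i_{r+1}`; `q_r = q_{(r,r+1)}`, `q̄_r = q_{(r+1,r)}`).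
[folklore] -/
theorem of_swap_mul_bkQ_self_mul_of_mem_eq {r r' : Fin n} (h : (r' : ℕ) = r + 1)
    {χ : Fin n → k} (hc : χ r = χ r') {w : MonoidAlgebra k (Perm (Fin n))}
    (hw : w ∈ jointEigenspace k χ) :
    MonoidAlgebra.of k _ (swap r r') * (bkQ k r r' χ * w) =
      bkQ k r' r χ * (MonoidAlgebra.of k _ (swap r r') * w) + 2 * w := by
  rw [bkQ_of_eq k hc, bkQ_of_eq k hc.symm, add_mul, one_mul, sub_mul, mul_add, mul_sub,
    of_swap_mul_bkNilpotent_succ_mul_of_mem_eq k h hc hw, of_swap_mul_bkNilpotent_mul_of_mem_eq k h hc hw,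
    add_mul, one_mul, sub_mul]
  noncomm_ring

/-- **`ψ_r w = q̄_r^{-1} (s_r w - w)` on `M_𝐢` for `i_r = i_{r+1}`**: `(s_r + 1) q_r^{-1} = q̄_r^{-1}(s_r - 1)`
on an equal-residue block. [folklore] -/
theorem bkPsi_mul_of_mem_eq {r r' : Fin n} (h : (r' : ℕ) = r + 1)
    {χ : Fin n → k} (hc : χ r = χ r') {w : MonoidAlgebra k (Perm (Fin n))}
    (hw : w ∈ jointEigenspace k χ) :
    bkPsi k r r' * w = Ring.inverse (bkQ k r' r χ) * (MonoidAlgebra.of k _ (swap r r') * w) -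
      Ring.inverse (bkQ k r' r χ) * w := by
  have hιw : Ring.inverse (bkQ k r r' χ) * w ∈ jointEigenspace k χ :=
    mul_mem_jointEigenspace_of_mem_yAlg k (ringInverse_bkQ_mem_yAlg k _ _ _) hw
  have hφ : bkPhi k r r' * (Ring.inverse (bkQ k r r' χ) * w) =
      (MonoidAlgebra.of k _ (swap r r') + 1) * (Ring.inverse (bkQ k r r' χ) * w) := by
    rw [← klrIdempotent_mul_of_mem k hιw, ← mul_assoc, bkPhi_mul_klrIdempotent_eq_swap_add_bkP,
      bkP, if_pos hc, mul_assoc]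
  have hinv := op_mul_ringInverse_mul_of_rule k
    (fun v hv => of_swap_mul_bkQ_self_mul_of_mem_eq k h hc hv) (isUnit_bkQ k r r' χ)
    (isUnit_bkQ k r' r χ)
    (fun v hv => mul_mem_jointEigenspace_of_mem_yAlg k (ringInverse_bkQ_mem_yAlg k _ _ _) hv) hw
  -- the scalar identity `ι q - 2 ι q̄ ι q = -ι q̄` (from `q + q̄ = 2`)
  have hqq : bkQ k r r' χ + bkQ k r' r χ = 2 := by
    rw [bkQ_of_eq k hc, bkQ_of_eq k hc.symm, add_add_add_comm, sub_add_sub_cancel, sub_self, add_zero,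
      one_add_one_eq_two]
  have hsc : Ring.inverse (bkQ k r r' χ) - Ring.inverse (bkQ k r' r χ) * (2 * Ring.inverse (bkQ k r r' χ)) =
      -Ring.inverse (bkQ k r' r χ) := by
    have hu'' := Ring.inverse_mul_cancel _ (isUnit_bkQ k r' r χ)
    calc Ring.inverse (bkQ k r r' χ) - Ring.inverse (bkQ k r' r χ) * (2 * Ring.inverse (bkQ k r r' χ))
        = Ring.inverse (bkQ k r r' χ) -
            Ring.inverse (bkQ k r' r χ) * ((bkQ k r r' χ + bkQ k r' r χ) * Ring.inverse (bkQ k r r' χ)) := by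
          rw [hqq]
      _ = -Ring.inverse (bkQ k r' r χ) := by
          rw [add_mul, mul_add, ← mul_assoc (Ring.inverse (bkQ k r' r χ)) (bkQ k r' r χ), hu'',
            one_mul, Ring.mul_inverse_cancel _ (isUnit_bkQ k r r' χ), mul_one]
          abel
  rw [bkPsi_mul_of_mem k r r' hw, hφ, add_mul, one_mul, hinv,
    show Ring.inverse (bkQ k r' r χ) * (2 * (Ring.inverse (bkQ k r r' χ) * w)) =
      Ring.inverse (bkQ k r' r χ) * (2 * Ring.inverse (bkQ k r r' χ)) * w by noncomm_ring,
    sub_add_eq_add_sub, add_sub_assoc, ← sub_mul, hsc, neg_mul, ← sub_eq_add_neg]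


/-- The six linear units on an all-equal block and their behaviour under `s_1`, `s_2`:
`s_2 q̄_1 = Ē s_2 + 1`, `s_2 Ē = q̄_1 s_2 - 1`, `s_1 q̄_2 = Ē s_1 + 1`, `s_1 Ē = q̄_2 s_1 - 1`,
`s_1 q̄_1 = q_1 s_1 - 2`, `s_2 q̄_2 = q_2 s_2 - 2` on `M_𝐢` (`q̄_1 = q_{(2,1)}`, `q̄_2 = q_{(3,2)}`,
`Ē = q_{(3,1)}`, `q_1 = q_{(1,2)}`, `q_2 = q_{(2,3)}`). [folklore] -/
theorem of_swap_mul_bkQ_rules {r r' r'' : Fin n} (h : (r' : ℕ) = r + 1) (h' : (r'' : ℕ) = r' + 1)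
    {χ : Fin n → k} (hc : χ r = χ r') (hc' : χ r' = χ r'') :
    (∀ w ∈ jointEigenspace k χ, MonoidAlgebra.of k _ (swap r' r'') * (bkQ k r' r χ * w) =
        bkQ k r'' r χ * (MonoidAlgebra.of k _ (swap r' r'') * w) + 1 * w) ∧
    (∀ w ∈ jointEigenspace k χ, MonoidAlgebra.of k _ (swap r' r'') * (bkQ k r'' r χ * w) =
        bkQ k r' r χ * (MonoidAlgebra.of k _ (swap r' r'') * w) + (-1) * w) ∧
    (∀ w ∈ jointEigenspace k χ, MonoidAlgebra.of k _ (swap r r') * (bkQ k r'' r' χ * w) =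
        bkQ k r'' r χ * (MonoidAlgebra.of k _ (swap r r') * w) + 1 * w) ∧
    (∀ w ∈ jointEigenspace k χ, MonoidAlgebra.of k _ (swap r r') * (bkQ k r'' r χ * w) =
        bkQ k r'' r' χ * (MonoidAlgebra.of k _ (swap r r') * w) + (-1) * w) ∧
    (∀ w ∈ jointEigenspace k χ, MonoidAlgebra.of k _ (swap r r') * (bkQ k r' r χ * w) =
        bkQ k r r' χ * (MonoidAlgebra.of k _ (swap r r') * w) + (-2) * w) ∧
    (∀ w ∈ jointEigenspace k χ, MonoidAlgebra.of k _ (swap r' r'') * (bkQ k r'' r' χ * w) =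
        bkQ k r' r'' χ * (MonoidAlgebra.of k _ (swap r' r'') * w) + (-2) * w) := by
  have hrr' : r ≠ r' := by intro e; rw [Fin.ext_iff] at e; omega
  have hr'r'' : r' ≠ r'' := by intro e; rw [Fin.ext_iff] at e; omega
  have hrr'' : r ≠ r'' := by intro e; rw [Fin.ext_iff] at e; omega
  have h13 : χ r = χ r'' := hc.trans hc'
  -- the basic `s`–`y` rules
  have A1 := fun w (hw : w ∈ jointEigenspace k χ) => of_swap_mul_bkNilpotent_mul_of_mem_eq k h hc hw
  have A2 := fun w (hw : w ∈ jointEigenspace k χ) => of_swap_mul_bkNilpotent_succ_mul_of_mem_eq k h hc hw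
  have B1 := fun w (hw : w ∈ jointEigenspace k χ) => of_swap_mul_bkNilpotent_mul_of_mem_eq k h' hc' hw
  have B2 := fun w (hw : w ∈ jointEigenspace k χ) => of_swap_mul_bkNilpotent_succ_mul_of_mem_eq k h' hc' hw
  have A3 : ∀ w, MonoidAlgebra.of k _ (swap r r') * (bkNilpotent k r'' * w) =
      bkNilpotent k r'' * (MonoidAlgebra.of k _ (swap r r') * w) := fun w => by
    rw [← mul_assoc, (commute_of_swap_bkNilpotent k h (Ne.symm hrr'') (Ne.symm hr'r'')).eq, mul_assoc]
  have B3 : ∀ w, MonoidAlgebra.of k _ (swap r' r'') * (bkNilpotent k r * w) =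
      bkNilpotent k r * (MonoidAlgebra.of k _ (swap r' r'') * w) := fun w => by
    rw [← mul_assoc, (commute_of_swap_bkNilpotent k h' hrr' hrr'').eq, mul_assoc]
  refine ⟨fun w hw => ?_, fun w hw => ?_, fun w hw => ?_, fun w hw => ?_, fun w hw => ?_, fun w hw => ?_⟩
  · rw [bkQ_of_eq k hc.symm, bkQ_of_eq k h13.symm, add_mul, one_mul, sub_mul, mul_add, mul_sub,
      B3, B1 w hw, add_mul, one_mul, sub_mul]
    noncomm_ring
  · rw [bkQ_of_eq k hc.symm, bkQ_of_eq k h13.symm, add_mul, one_mul, sub_mul, mul_add, mul_sub,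
      B3, B2 w hw, add_mul, one_mul, sub_mul]
    noncomm_ring
  · rw [bkQ_of_eq k hc'.symm, bkQ_of_eq k h13.symm, add_mul, one_mul, sub_mul, mul_add, mul_sub,
      A2 w hw, A3, add_mul, one_mul, sub_mul]
    noncomm_ring
  · rw [bkQ_of_eq k hc'.symm, bkQ_of_eq k h13.symm, add_mul, one_mul, sub_mul, mul_add, mul_sub,
      A1 w hw, A3, add_mul, one_mul, sub_mul]
    noncomm_ring
  · rw [bkQ_of_eq k hc.symm, bkQ_of_eq k hc, add_mul, one_mul, sub_mul, mul_add, mul_sub,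
      A1 w hw, A2 w hw, add_mul, one_mul, sub_mul]
    noncomm_ring
  · rw [bkQ_of_eq k hc'.symm, bkQ_of_eq k hc', add_mul, one_mul, sub_mul, mul_add, mul_sub,
      B1 w hw, B2 w hw, add_mul, one_mul, sub_mul]
    noncomm_ring

/-- The composite moves on an all-equal block: `s_1` commutes with `q̄_2^{-1}Ē^{-1}`, `s_2` with
`q̄_1^{-1}Ē^{-1}` (these products are `s`-invariant), while
`s_1 q̄_1^{-1}Ē^{-1} X = q_1^{-1}q̄_2^{-1} s_1 X + (q_1^{-1}q̄_2^{-1}Ē^{-1} + 2q_1^{-1}q̄_1^{-1}Ē^{-1}) X`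
and symmetrically for `s_2 q̄_2^{-1}Ē^{-1}`. [folklore] -/
theorem of_swap_mul_moves {r r' r'' : Fin n} (h : (r' : ℕ) = r + 1) (h' : (r'' : ℕ) = r' + 1)
    {χ : Fin n → k} (hc : χ r = χ r') (hc' : χ r' = χ r'') :
    (∀ X ∈ jointEigenspace k χ, MonoidAlgebra.of k _ (swap r r') *
        (Ring.inverse (bkQ k r'' r' χ) * (Ring.inverse (bkQ k r'' r χ) * X)) =
        Ring.inverse (bkQ k r'' r χ) * (Ring.inverse (bkQ k r'' r' χ) * (MonoidAlgebra.of k _ (swap r r') * X))) ∧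
    (∀ X ∈ jointEigenspace k χ, MonoidAlgebra.of k _ (swap r' r'') *
        (Ring.inverse (bkQ k r' r χ) * (Ring.inverse (bkQ k r'' r χ) * X)) =
        Ring.inverse (bkQ k r'' r χ) * (Ring.inverse (bkQ k r' r χ) * (MonoidAlgebra.of k _ (swap r' r'') * X))) ∧
    (∀ X ∈ jointEigenspace k χ, MonoidAlgebra.of k _ (swap r r') *
        (Ring.inverse (bkQ k r' r χ) * (Ring.inverse (bkQ k r'' r χ) * X)) =
        Ring.inverse (bkQ k r r' χ) * (Ring.inverse (bkQ k r'' r' χ) * (MonoidAlgebra.of k _ (swap r r') * X)) +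
          (Ring.inverse (bkQ k r r' χ) * Ring.inverse (bkQ k r'' r' χ) * Ring.inverse (bkQ k r'' r χ) +
            2 * (Ring.inverse (bkQ k r r' χ) * Ring.inverse (bkQ k r' r χ) * Ring.inverse (bkQ k r'' r χ))) * X) ∧
    (∀ X ∈ jointEigenspace k χ, MonoidAlgebra.of k _ (swap r' r'') *
        (Ring.inverse (bkQ k r'' r' χ) * (Ring.inverse (bkQ k r'' r χ) * X)) =
        Ring.inverse (bkQ k r' r'' χ) * (Ring.inverse (bkQ k r' r χ) * (MonoidAlgebra.of k _ (swap r' r'') * X)) +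
          (Ring.inverse (bkQ k r' r'' χ) * Ring.inverse (bkQ k r' r χ) * Ring.inverse (bkQ k r'' r χ) +
            2 * (Ring.inverse (bkQ k r' r'' χ) * Ring.inverse (bkQ k r'' r' χ) * Ring.inverse (bkQ k r'' r χ))) * X) := by
  obtain ⟨R1, R2, R3, R4, R5, R6⟩ := of_swap_mul_bkQ_rules k h h' hc hc'
  have hM : ∀ (a b : Fin n) {w}, w ∈ jointEigenspace k χ → Ring.inverse (bkQ k a b χ) * w ∈ jointEigenspace k χ :=
    fun a b w hw => mul_mem_jointEigenspace_of_mem_yAlg k (ringInverse_bkQ_mem_yAlg k _ _ _) hw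
  have hu := fun a b => isUnit_bkQ k a b χ
  have I1 := fun w (hw : w ∈ jointEigenspace k χ) =>
    op_mul_ringInverse_mul_of_rule k R1 (hu _ _) (hu _ _) (fun v hv => hM _ _ hv) hw
  have I2 := fun w (hw : w ∈ jointEigenspace k χ) =>
    op_mul_ringInverse_mul_of_rule k R2 (hu _ _) (hu _ _) (fun v hv => hM _ _ hv) hw
  have I3 := fun w (hw : w ∈ jointEigenspace k χ) =>
    op_mul_ringInverse_mul_of_rule k R3 (hu _ _) (hu _ _) (fun v hv => hM _ _ hv) hw
  have I4 := fun w (hw : w ∈ jointEigenspace k χ) =>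
    op_mul_ringInverse_mul_of_rule k R4 (hu _ _) (hu _ _) (fun v hv => hM _ _ hv) hw
  have I5 := fun w (hw : w ∈ jointEigenspace k χ) =>
    op_mul_ringInverse_mul_of_rule k R5 (hu _ _) (hu _ _) (fun v hv => hM _ _ hv) hw
  have I6 := fun w (hw : w ∈ jointEigenspace k χ) =>
    op_mul_ringInverse_mul_of_rule k R6 (hu _ _) (hu _ _) (fun v hv => hM _ _ hv) hw
  refine ⟨fun X hX => ?_, fun X hX => ?_, fun X hX => ?_, fun X hX => ?_⟩
  · rw [I3 _ (hM _ _ hX), I4 _ hX]; noncomm_ring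
  · rw [I1 _ (hM _ _ hX), I2 _ hX]; noncomm_ring
  · rw [I5 _ (hM _ _ hX), I4 _ hX]; noncomm_ring
  · rw [I6 _ (hM _ _ hX), I2 _ hX]; noncomm_ring

open scoped IsMulCommutative in
/-- The four scalar identities of Case 5 in `Y''` (`q̄_1 = 1 + y_1 - y_2`, `q̄_2 = 1 + y_2 - y_3`,
`Ē = 1 + y_1 - y_3`, `q_1 = 1 + y_2 - y_1`, `q_2 = 1 + y_3 - y_2`; inverses `ū_1, ū_2, ē, u_1, u_2`):
`ū_2ē - ū_2ēū_1 - ū_2ū_1 = -ū_1ē`, its mirror, and the two "`c = -F`" identities. [folklore] -/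
theorem bkCase5_scalars {r r' r'' : Fin n} {χ : Fin n → k} (hc : χ r = χ r') (hc' : χ r' = χ r'') :
    (-(Ring.inverse (bkQ k r'' r' χ) * Ring.inverse (bkQ k r'' r χ) * Ring.inverse (bkQ k r' r χ)) -
        Ring.inverse (bkQ k r'' r' χ) * Ring.inverse (bkQ k r' r χ) +
        Ring.inverse (bkQ k r'' r' χ) * Ring.inverse (bkQ k r'' r χ) +
        Ring.inverse (bkQ k r' r χ) * Ring.inverse (bkQ k r'' r χ) = 0) ∧
    (-(Ring.inverse (bkQ k r' r χ) * Ring.inverse (bkQ k r'' r χ) * Ring.inverse (bkQ k r'' r' χ)) -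
        Ring.inverse (bkQ k r' r χ) * Ring.inverse (bkQ k r'' r' χ) +
        Ring.inverse (bkQ k r' r χ) * Ring.inverse (bkQ k r'' r χ) +
        Ring.inverse (bkQ k r'' r' χ) * Ring.inverse (bkQ k r'' r χ) = 0) ∧
    (Ring.inverse (bkQ k r' r χ) * Ring.inverse (bkQ k r r' χ) * Ring.inverse (bkQ k r'' r' χ) -
        Ring.inverse (bkQ k r' r χ) * (Ring.inverse (bkQ k r r' χ) * Ring.inverse (bkQ k r'' r' χ) *
          Ring.inverse (bkQ k r'' r χ)) -
        Ring.inverse (bkQ k r' r χ) * (2 * (Ring.inverse (bkQ k r r' χ) * Ring.inverse (bkQ k r' r χ) *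
          Ring.inverse (bkQ k r'' r χ))) +
        Ring.inverse (bkQ k r' r χ) * Ring.inverse (bkQ k r' r χ) * Ring.inverse (bkQ k r'' r χ) +
        Ring.inverse (bkQ k r' r χ) * Ring.inverse (bkQ k r'' r' χ) * Ring.inverse (bkQ k r'' r χ) = 0) ∧
    (Ring.inverse (bkQ k r'' r' χ) * Ring.inverse (bkQ k r' r'' χ) * Ring.inverse (bkQ k r' r χ) -
        Ring.inverse (bkQ k r'' r' χ) * (Ring.inverse (bkQ k r' r'' χ) * Ring.inverse (bkQ k r' r χ) *
          Ring.inverse (bkQ k r'' r χ)) -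
        Ring.inverse (bkQ k r'' r' χ) * (2 * (Ring.inverse (bkQ k r' r'' χ) * Ring.inverse (bkQ k r'' r' χ) *
          Ring.inverse (bkQ k r'' r χ))) +
        Ring.inverse (bkQ k r'' r' χ) * Ring.inverse (bkQ k r'' r' χ) * Ring.inverse (bkQ k r'' r χ) +
        Ring.inverse (bkQ k r'' r' χ) * Ring.inverse (bkQ k r' r χ) * Ring.inverse (bkQ k r'' r χ) = 0) := by
  have h13 : χ r = χ r'' := hc.trans hc'
  obtain ⟨ub1, hub1⟩ : ∃ u : yAlg k n, (u : MonoidAlgebra k (Perm (Fin n))) = Ring.inverse (bkQ k r' r χ) :=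
    ⟨⟨_, ringInverse_bkQ_mem_yAlg k _ _ _⟩, rfl⟩
  obtain ⟨ub2, hub2⟩ : ∃ u : yAlg k n, (u : MonoidAlgebra k (Perm (Fin n))) = Ring.inverse (bkQ k r'' r' χ) :=
    ⟨⟨_, ringInverse_bkQ_mem_yAlg k _ _ _⟩, rfl⟩
  obtain ⟨eb, heb⟩ : ∃ u : yAlg k n, (u : MonoidAlgebra k (Perm (Fin n))) = Ring.inverse (bkQ k r'' r χ) :=
    ⟨⟨_, ringInverse_bkQ_mem_yAlg k _ _ _⟩, rfl⟩
  obtain ⟨u1, hu1⟩ : ∃ u : yAlg k n, (u : MonoidAlgebra k (Perm (Fin n))) = Ring.inverse (bkQ k r r' χ) :=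
    ⟨⟨_, ringInverse_bkQ_mem_yAlg k _ _ _⟩, rfl⟩
  obtain ⟨u2, hu2⟩ : ∃ u : yAlg k n, (u : MonoidAlgebra k (Perm (Fin n))) = Ring.inverse (bkQ k r' r'' χ) :=
    ⟨⟨_, ringInverse_bkQ_mem_yAlg k _ _ _⟩, rfl⟩
  obtain ⟨Y1, hY1⟩ : ∃ Y : yAlg k n, (Y : MonoidAlgebra k (Perm (Fin n))) = bkNilpotent k r :=
    ⟨⟨_, bkNilpotent_mem_yAlg k _⟩, rfl⟩
  obtain ⟨Y2, hY2⟩ : ∃ Y : yAlg k n, (Y : MonoidAlgebra k (Perm (Fin n))) = bkNilpotent k r' :=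
    ⟨⟨_, bkNilpotent_mem_yAlg k _⟩, rfl⟩
  obtain ⟨Y3, hY3⟩ : ∃ Y : yAlg k n, (Y : MonoidAlgebra k (Perm (Fin n))) = bkNilpotent k r'' :=
    ⟨⟨_, bkNilpotent_mem_yAlg k _⟩, rfl⟩
  have Rb1 := Ring.inverse_mul_cancel _ (isUnit_bkQ k r' r χ)
  have Rb2 := Ring.inverse_mul_cancel _ (isUnit_bkQ k r'' r' χ)
  have Re := Ring.inverse_mul_cancel _ (isUnit_bkQ k r'' r χ)
  have R1 := Ring.inverse_mul_cancel _ (isUnit_bkQ k r r' χ)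
  have R2 := Ring.inverse_mul_cancel _ (isUnit_bkQ k r' r'' χ)
  rw [← hub1, bkQ_of_eq k hc.symm, ← hY1, ← hY2] at Rb1
  rw [← hub2, bkQ_of_eq k hc'.symm, ← hY2, ← hY3] at Rb2
  rw [← heb, bkQ_of_eq k h13.symm, ← hY1, ← hY3] at Re
  rw [← hu1, bkQ_of_eq k hc, ← hY1, ← hY2] at R1
  rw [← hu2, bkQ_of_eq k hc', ← hY2, ← hY3] at R2
  have Rb1' : ub1 * (1 + (Y1 - Y2)) = 1 := by exact_mod_cast Rb1
  have Rb2' : ub2 * (1 + (Y2 - Y3)) = 1 := by exact_mod_cast Rb2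
  have Re' : eb * (1 + (Y1 - Y3)) = 1 := by exact_mod_cast Re
  have R1' : u1 * (1 + (Y2 - Y1)) = 1 := by exact_mod_cast R1
  have R2' : u2 * (1 + (Y3 - Y2)) = 1 := by exact_mod_cast R2
  rw [← hub1, ← hub2, ← heb, ← hu1, ← hu2]
  refine ⟨?_, ?_, ?_, ?_⟩
  · exact_mod_cast (show -(ub2 * eb * ub1) - ub2 * ub1 + ub2 * eb + ub1 * eb = (0 : yAlg k n) by
      linear_combination (-eb * ub2) * Rb1' + (-eb * ub1) * Rb2' + (ub1 * ub2) * Re')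
  · exact_mod_cast (show -(ub1 * eb * ub2) - ub1 * ub2 + ub1 * eb + ub2 * eb = (0 : yAlg k n) by
      linear_combination (-eb * ub2) * Rb1' + (-eb * ub1) * Rb2' + (ub1 * ub2) * Re')
  · rw [two_mul]
    exact_mod_cast (show ub1 * u1 * ub2 - ub1 * (u1 * ub2 * eb) - ub1 * (u1 * ub1 * eb + u1 * ub1 * eb) +
        ub1 * ub1 * eb + ub1 * ub2 * eb = (0 : yAlg k n) by
      linear_combination (eb * u1 * ub1 * ub2 - eb * ub1 * ub2 - u1 * ub1 * ub2) * Rb1' +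
        (2 * eb * u1 * ub1 ^ 2 - eb * ub1 ^ 2) * Rb2' +
        (-Y1 * u1 * ub1 ^ 2 * ub2 + Y2 * u1 * ub1 ^ 2 * ub2 - u1 * ub1 ^ 2 * ub2) * Re' +
        (-Y1 * eb * ub1 ^ 2 * ub2 + Y3 * eb * ub1 ^ 2 * ub2 - 2 * eb * ub1 ^ 2 * ub2) * R1')
  · rw [two_mul]
    exact_mod_cast (show ub2 * u2 * ub1 - ub2 * (u2 * ub1 * eb) - ub2 * (u2 * ub2 * eb + u2 * ub2 * eb) +
        ub2 * ub2 * eb + ub2 * ub1 * eb = (0 : yAlg k n) by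
      linear_combination (2 * eb * u2 * ub2 ^ 2 - eb * ub2 ^ 2) * Rb1' +
        (eb * u2 * ub1 * ub2 - eb * ub1 * ub2 - u2 * ub1 * ub2) * Rb2' +
        (-Y2 * u2 * ub1 * ub2 ^ 2 + Y3 * u2 * ub1 * ub2 ^ 2 - u2 * ub1 * ub2 ^ 2) * Re' +
        (-Y1 * eb * ub1 * ub2 ^ 2 + Y3 * eb * ub1 * ub2 ^ 2 - 2 * eb * ub1 * ub2 ^ 2) * R2')

/-- The six inverse rules on an all-equal block (`∂` of the inverses of `q̄_1`, `Ē`, `q̄_2` under `s_1`,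
`s_2`). [folklore] -/
theorem of_swap_mul_inv_rules {r r' r'' : Fin n} (h : (r' : ℕ) = r + 1) (h' : (r'' : ℕ) = r' + 1)
    {χ : Fin n → k} (hc : χ r = χ r') (hc' : χ r' = χ r'') :
    (∀ w ∈ jointEigenspace k χ, MonoidAlgebra.of k _ (swap r' r'') * (Ring.inverse (bkQ k r' r χ) * w) =
        Ring.inverse (bkQ k r'' r χ) * (MonoidAlgebra.of k _ (swap r' r'') * w) -
          Ring.inverse (bkQ k r'' r χ) * (1 * (Ring.inverse (bkQ k r' r χ) * w))) ∧
    (∀ w ∈ jointEigenspace k χ, MonoidAlgebra.of k _ (swap r r') * (Ring.inverse (bkQ k r'' r' χ) * w) =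
        Ring.inverse (bkQ k r'' r χ) * (MonoidAlgebra.of k _ (swap r r') * w) -
          Ring.inverse (bkQ k r'' r χ) * (1 * (Ring.inverse (bkQ k r'' r' χ) * w))) := by
  obtain ⟨R1, -, R3, -, -, -⟩ := of_swap_mul_bkQ_rules k h h' hc hc'
  have hM : ∀ (a b : Fin n) {w}, w ∈ jointEigenspace k χ → Ring.inverse (bkQ k a b χ) * w ∈ jointEigenspace k χ :=
    fun a b w hw => mul_mem_jointEigenspace_of_mem_yAlg k (ringInverse_bkQ_mem_yAlg k _ _ _) hw
  exact ⟨fun w hw => op_mul_ringInverse_mul_of_rule k R1 (isUnit_bkQ k _ _ _) (isUnit_bkQ k _ _ _)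
      (fun v hv => hM _ _ hv) hw,
    fun w hw => op_mul_ringInverse_mul_of_rule k R3 (isUnit_bkQ k _ _ _) (isUnit_bkQ k _ _ _)
      (fun v hv => hM _ _ hv) hw⟩

/-- **`ψ_2ψ_1 e = ū_2ē (s_2Y - Y) - ū_1ē Y`** on an all-equal block, `Y = s_1 e - e`. [folklore] -/
theorem bkPsi_psi21_of_eq_eq {r r' r'' : Fin n} (h : (r' : ℕ) = r + 1) (h' : (r'' : ℕ) = r' + 1)
    {χ : Fin n → k} (hc : χ r = χ r') (hc' : χ r' = χ r'') :
    bkPsi k r' r'' * (bkPsi k r r' * klrIdempotent k χ) =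
      Ring.inverse (bkQ k r'' r' χ) * (Ring.inverse (bkQ k r'' r χ) *
        (MonoidAlgebra.of k _ (swap r' r'') * (MonoidAlgebra.of k _ (swap r r') * klrIdempotent k χ -
          klrIdempotent k χ) - (MonoidAlgebra.of k _ (swap r r') * klrIdempotent k χ - klrIdempotent k χ))) -
      Ring.inverse (bkQ k r' r χ) * (Ring.inverse (bkQ k r'' r χ) *
        (MonoidAlgebra.of k _ (swap r r') * klrIdempotent k χ - klrIdempotent k χ)) := by
  have he := klrIdempotent_mem k χ
  have hY : MonoidAlgebra.of k _ (swap r r') * klrIdempotent k χ - klrIdempotent k χ ∈ jointEigenspace k χ :=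
    sub_mem (of_swap_mul_mem_of_eq k h hc he) he
  have hM : ∀ (a b : Fin n) {w}, w ∈ jointEigenspace k χ → Ring.inverse (bkQ k a b χ) * w ∈ jointEigenspace k χ :=
    fun a b w hw => mul_mem_jointEigenspace_of_mem_yAlg k (ringInverse_bkQ_mem_yAlg k _ _ _) hw
  obtain ⟨I1, -⟩ := of_swap_mul_inv_rules k h h' hc hc'
  obtain ⟨S1, -, -, -⟩ := bkCase5_scalars k hc hc'
  rw [bkPsi_mul_of_mem_eq k h hc he, ← mul_sub, bkPsi_mul_of_mem_eq k h' hc' (hM _ _ hY), I1 _ hY,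
    ← sub_eq_zero]
  rw [show Ring.inverse (bkQ k r'' r' χ) * (Ring.inverse (bkQ k r'' r χ) *
      (MonoidAlgebra.of k _ (swap r' r'') * (MonoidAlgebra.of k _ (swap r r') * klrIdempotent k χ -
        klrIdempotent k χ)) - Ring.inverse (bkQ k r'' r χ) * (1 * (Ring.inverse (bkQ k r' r χ) *
        (MonoidAlgebra.of k _ (swap r r') * klrIdempotent k χ - klrIdempotent k χ)))) -
      Ring.inverse (bkQ k r'' r' χ) * (Ring.inverse (bkQ k r' r χ) *
        (MonoidAlgebra.of k _ (swap r r') * klrIdempotent k χ - klrIdempotent k χ)) -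
      (Ring.inverse (bkQ k r'' r' χ) * (Ring.inverse (bkQ k r'' r χ) *
        (MonoidAlgebra.of k _ (swap r' r'') * (MonoidAlgebra.of k _ (swap r r') * klrIdempotent k χ -
          klrIdempotent k χ) - (MonoidAlgebra.of k _ (swap r r') * klrIdempotent k χ - klrIdempotent k χ))) -
      Ring.inverse (bkQ k r' r χ) * (Ring.inverse (bkQ k r'' r χ) *
        (MonoidAlgebra.of k _ (swap r r') * klrIdempotent k χ - klrIdempotent k χ))) =
      (-(Ring.inverse (bkQ k r'' r' χ) * Ring.inverse (bkQ k r'' r χ) * Ring.inverse (bkQ k r' r χ)) -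
        Ring.inverse (bkQ k r'' r' χ) * Ring.inverse (bkQ k r' r χ) +
        Ring.inverse (bkQ k r'' r' χ) * Ring.inverse (bkQ k r'' r χ) +
        Ring.inverse (bkQ k r' r χ) * Ring.inverse (bkQ k r'' r χ)) *
      (MonoidAlgebra.of k _ (swap r r') * klrIdempotent k χ - klrIdempotent k χ) by noncomm_ring,
    S1, zero_mul]

/-- **`ψ_1ψ_2 e = ū_1ē (s_1Y' - Y') - ū_2ē Y'`** on an all-equal block, `Y' = s_2 e - e`. [folklore] -/
theorem bkPsi_psi12_of_eq_eq {r r' r'' : Fin n} (h : (r' : ℕ) = r + 1) (h' : (r'' : ℕ) = r' + 1)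
    {χ : Fin n → k} (hc : χ r = χ r') (hc' : χ r' = χ r'') :
    bkPsi k r r' * (bkPsi k r' r'' * klrIdempotent k χ) =
      Ring.inverse (bkQ k r' r χ) * (Ring.inverse (bkQ k r'' r χ) *
        (MonoidAlgebra.of k _ (swap r r') * (MonoidAlgebra.of k _ (swap r' r'') * klrIdempotent k χ -
          klrIdempotent k χ) - (MonoidAlgebra.of k _ (swap r' r'') * klrIdempotent k χ - klrIdempotent k χ))) -
      Ring.inverse (bkQ k r'' r' χ) * (Ring.inverse (bkQ k r'' r χ) *
        (MonoidAlgebra.of k _ (swap r' r'') * klrIdempotent k χ - klrIdempotent k χ)) := by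
  have he := klrIdempotent_mem k χ
  have hY : MonoidAlgebra.of k _ (swap r' r'') * klrIdempotent k χ - klrIdempotent k χ ∈ jointEigenspace k χ :=
    sub_mem (of_swap_mul_mem_of_eq k h' hc' he) he
  have hM : ∀ (a b : Fin n) {w}, w ∈ jointEigenspace k χ → Ring.inverse (bkQ k a b χ) * w ∈ jointEigenspace k χ :=
    fun a b w hw => mul_mem_jointEigenspace_of_mem_yAlg k (ringInverse_bkQ_mem_yAlg k _ _ _) hw
  obtain ⟨-, I3⟩ := of_swap_mul_inv_rules k h h' hc hc'
  obtain ⟨-, S1', -, -⟩ := bkCase5_scalars k hc hc'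
  rw [bkPsi_mul_of_mem_eq k h' hc' he, ← mul_sub, bkPsi_mul_of_mem_eq k h hc (hM _ _ hY), I3 _ hY,
    ← sub_eq_zero]
  rw [show Ring.inverse (bkQ k r' r χ) * (Ring.inverse (bkQ k r'' r χ) *
      (MonoidAlgebra.of k _ (swap r r') * (MonoidAlgebra.of k _ (swap r' r'') * klrIdempotent k χ -
        klrIdempotent k χ)) - Ring.inverse (bkQ k r'' r χ) * (1 * (Ring.inverse (bkQ k r'' r' χ) *
        (MonoidAlgebra.of k _ (swap r' r'') * klrIdempotent k χ - klrIdempotent k χ)))) -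
      Ring.inverse (bkQ k r' r χ) * (Ring.inverse (bkQ k r'' r' χ) *
        (MonoidAlgebra.of k _ (swap r' r'') * klrIdempotent k χ - klrIdempotent k χ)) -
      (Ring.inverse (bkQ k r' r χ) * (Ring.inverse (bkQ k r'' r χ) *
        (MonoidAlgebra.of k _ (swap r r') * (MonoidAlgebra.of k _ (swap r' r'') * klrIdempotent k χ -
          klrIdempotent k χ) - (MonoidAlgebra.of k _ (swap r' r'') * klrIdempotent k χ - klrIdempotent k χ))) -
      Ring.inverse (bkQ k r'' r' χ) * (Ring.inverse (bkQ k r'' r χ) *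
        (MonoidAlgebra.of k _ (swap r' r'') * klrIdempotent k χ - klrIdempotent k χ))) =
      (-(Ring.inverse (bkQ k r' r χ) * Ring.inverse (bkQ k r'' r χ) * Ring.inverse (bkQ k r'' r' χ)) -
        Ring.inverse (bkQ k r' r χ) * Ring.inverse (bkQ k r'' r' χ) +
        Ring.inverse (bkQ k r' r χ) * Ring.inverse (bkQ k r'' r χ) +
        Ring.inverse (bkQ k r'' r' χ) * Ring.inverse (bkQ k r'' r χ)) *
      (MonoidAlgebra.of k _ (swap r' r'') * klrIdempotent k χ - klrIdempotent k χ) by noncomm_ring,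
    S1', zero_mul]

/-- Case 5, left-hand side: `ψ_1ψ_2ψ_1 e = ū_1 ē ū_2 s_1Z - ū_1ū_2ē Z - ū_1ū_2ē Y` with `Y = s_1e - e`,
`Z = s_2Y - Y` (the `Y`-coefficient collapsing to `-F` by `bkCase5_scalars`). [folklore] -/
theorem bkPsi_triple_case5_lhs {r r' r'' : Fin n} (h : (r' : ℕ) = r + 1) (h' : (r'' : ℕ) = r' + 1)
    {χ : Fin n → k} (hc : χ r = χ r') (hc' : χ r' = χ r'') :
    bkPsi k r r' * (bkPsi k r' r'' * (bkPsi k r r' * klrIdempotent k χ)) =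
      Ring.inverse (bkQ k r' r χ) * (Ring.inverse (bkQ k r'' r χ) * (Ring.inverse (bkQ k r'' r' χ) *
        (MonoidAlgebra.of k _ (swap r r') *
          (MonoidAlgebra.of k _ (swap r' r'') * (MonoidAlgebra.of k _ (swap r r') * klrIdempotent k χ -
            klrIdempotent k χ) - (MonoidAlgebra.of k _ (swap r r') * klrIdempotent k χ - klrIdempotent k χ))))) -
      Ring.inverse (bkQ k r' r χ) * (Ring.inverse (bkQ k r'' r' χ) * (Ring.inverse (bkQ k r'' r χ) *
          (MonoidAlgebra.of k _ (swap r' r'') * (MonoidAlgebra.of k _ (swap r r') * klrIdempotent k χ -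
            klrIdempotent k χ) - (MonoidAlgebra.of k _ (swap r r') * klrIdempotent k χ - klrIdempotent k χ)))) -
      Ring.inverse (bkQ k r' r χ) * (Ring.inverse (bkQ k r'' r' χ) * (Ring.inverse (bkQ k r'' r χ) *
          (MonoidAlgebra.of k _ (swap r r') * klrIdempotent k χ - klrIdempotent k χ))) := by
  have he := klrIdempotent_mem k χ
  have hY : MonoidAlgebra.of k _ (swap r r') * klrIdempotent k χ - klrIdempotent k χ ∈ jointEigenspace k χ :=
    sub_mem (of_swap_mul_mem_of_eq k h hc he) he
  have hZ : MonoidAlgebra.of k _ (swap r' r'') * (MonoidAlgebra.of k _ (swap r r') * klrIdempotent k χ -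
      klrIdempotent k χ) - (MonoidAlgebra.of k _ (swap r r') * klrIdempotent k χ - klrIdempotent k χ) ∈
      jointEigenspace k χ := sub_mem (of_swap_mul_mem_of_eq k h' hc' hY) hY
  have hM : ∀ (a b : Fin n) {w}, w ∈ jointEigenspace k χ → Ring.inverse (bkQ k a b χ) * w ∈ jointEigenspace k χ :=
    fun a b w hw => mul_mem_jointEigenspace_of_mem_yAlg k (ringInverse_bkQ_mem_yAlg k _ _ _) hw
  obtain ⟨P1, -, P3, -⟩ := of_swap_mul_moves k h h' hc hc'
  obtain ⟨-, -, S2, -⟩ := bkCase5_scalars k hc hc'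
  have hsY : MonoidAlgebra.of k _ (swap r r') * (MonoidAlgebra.of k _ (swap r r') * klrIdempotent k χ -
      klrIdempotent k χ) = -(MonoidAlgebra.of k _ (swap r r') * klrIdempotent k χ - klrIdempotent k χ) := by
    rw [mul_sub, ← mul_assoc, of_swap_mul_self, one_mul, neg_sub]
  rw [bkPsi_psi21_of_eq_eq k h h' hc hc', mul_sub, bkPsi_mul_of_mem_eq k h hc (hM _ _ (hM _ _ hZ)),
    bkPsi_mul_of_mem_eq k h hc (hM _ _ (hM _ _ hY)), P1 _ hZ, P3 _ hY, hsY, ← sub_eq_zero]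
  rw [show Ring.inverse (bkQ k r' r χ) * (Ring.inverse (bkQ k r'' r χ) * (Ring.inverse (bkQ k r'' r' χ) *
      (MonoidAlgebra.of k _ (swap r r') * (MonoidAlgebra.of k _ (swap r' r'') *
        (MonoidAlgebra.of k _ (swap r r') * klrIdempotent k χ - klrIdempotent k χ) -
        (MonoidAlgebra.of k _ (swap r r') * klrIdempotent k χ - klrIdempotent k χ))))) -
      Ring.inverse (bkQ k r' r χ) * (Ring.inverse (bkQ k r'' r' χ) * (Ring.inverse (bkQ k r'' r χ) *
        (MonoidAlgebra.of k _ (swap r' r'') * (MonoidAlgebra.of k _ (swap r r') * klrIdempotent k χ -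
          klrIdempotent k χ) - (MonoidAlgebra.of k _ (swap r r') * klrIdempotent k χ - klrIdempotent k χ)))) -
      (Ring.inverse (bkQ k r' r χ) * (Ring.inverse (bkQ k r r' χ) * (Ring.inverse (bkQ k r'' r' χ) *
          -(MonoidAlgebra.of k _ (swap r r') * klrIdempotent k χ - klrIdempotent k χ)) +
        (Ring.inverse (bkQ k r r' χ) * Ring.inverse (bkQ k r'' r' χ) * Ring.inverse (bkQ k r'' r χ) +
          2 * (Ring.inverse (bkQ k r r' χ) * Ring.inverse (bkQ k r' r χ) * Ring.inverse (bkQ k r'' r χ))) *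
          (MonoidAlgebra.of k _ (swap r r') * klrIdempotent k χ - klrIdempotent k χ)) -
        Ring.inverse (bkQ k r' r χ) * (Ring.inverse (bkQ k r' r χ) * (Ring.inverse (bkQ k r'' r χ) *
          (MonoidAlgebra.of k _ (swap r r') * klrIdempotent k χ - klrIdempotent k χ)))) -
      (Ring.inverse (bkQ k r' r χ) * (Ring.inverse (bkQ k r'' r χ) * (Ring.inverse (bkQ k r'' r' χ) *
        (MonoidAlgebra.of k _ (swap r r') * (MonoidAlgebra.of k _ (swap r' r'') *
          (MonoidAlgebra.of k _ (swap r r') * klrIdempotent k χ - klrIdempotent k χ) -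
          (MonoidAlgebra.of k _ (swap r r') * klrIdempotent k χ - klrIdempotent k χ))))) -
      Ring.inverse (bkQ k r' r χ) * (Ring.inverse (bkQ k r'' r' χ) * (Ring.inverse (bkQ k r'' r χ) *
        (MonoidAlgebra.of k _ (swap r' r'') * (MonoidAlgebra.of k _ (swap r r') * klrIdempotent k χ -
          klrIdempotent k χ) - (MonoidAlgebra.of k _ (swap r r') * klrIdempotent k χ - klrIdempotent k χ)))) -
      Ring.inverse (bkQ k r' r χ) * (Ring.inverse (bkQ k r'' r' χ) * (Ring.inverse (bkQ k r'' r χ) *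
        (MonoidAlgebra.of k _ (swap r r') * klrIdempotent k χ - klrIdempotent k χ)))) =
      (Ring.inverse (bkQ k r' r χ) * Ring.inverse (bkQ k r r' χ) * Ring.inverse (bkQ k r'' r' χ) -
        Ring.inverse (bkQ k r' r χ) * (Ring.inverse (bkQ k r r' χ) * Ring.inverse (bkQ k r'' r' χ) *
          Ring.inverse (bkQ k r'' r χ)) -
        Ring.inverse (bkQ k r' r χ) * (2 * (Ring.inverse (bkQ k r r' χ) * Ring.inverse (bkQ k r' r χ) *
          Ring.inverse (bkQ k r'' r χ))) +
        Ring.inverse (bkQ k r' r χ) * Ring.inverse (bkQ k r' r χ) * Ring.inverse (bkQ k r'' r χ) +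
        Ring.inverse (bkQ k r' r χ) * Ring.inverse (bkQ k r'' r' χ) * Ring.inverse (bkQ k r'' r χ)) *
      (MonoidAlgebra.of k _ (swap r r') * klrIdempotent k χ - klrIdempotent k χ) by noncomm_ring,
    S2, zero_mul]

/-- Case 5, right-hand side (mirror). [folklore] -/
theorem bkPsi_triple_case5_rhs {r r' r'' : Fin n} (h : (r' : ℕ) = r + 1) (h' : (r'' : ℕ) = r' + 1)
    {χ : Fin n → k} (hc : χ r = χ r') (hc' : χ r' = χ r'') :
    bkPsi k r' r'' * (bkPsi k r r' * (bkPsi k r' r'' * klrIdempotent k χ)) =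
      Ring.inverse (bkQ k r'' r' χ) * (Ring.inverse (bkQ k r'' r χ) * (Ring.inverse (bkQ k r' r χ) *
        (MonoidAlgebra.of k _ (swap r' r'') *
          (MonoidAlgebra.of k _ (swap r r') * (MonoidAlgebra.of k _ (swap r' r'') * klrIdempotent k χ -
            klrIdempotent k χ) - (MonoidAlgebra.of k _ (swap r' r'') * klrIdempotent k χ - klrIdempotent k χ))))) -
      Ring.inverse (bkQ k r'' r' χ) * (Ring.inverse (bkQ k r' r χ) * (Ring.inverse (bkQ k r'' r χ) *
          (MonoidAlgebra.of k _ (swap r r') * (MonoidAlgebra.of k _ (swap r' r'') * klrIdempotent k χ -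
            klrIdempotent k χ) - (MonoidAlgebra.of k _ (swap r' r'') * klrIdempotent k χ - klrIdempotent k χ)))) -
      Ring.inverse (bkQ k r'' r' χ) * (Ring.inverse (bkQ k r' r χ) * (Ring.inverse (bkQ k r'' r χ) *
          (MonoidAlgebra.of k _ (swap r' r'') * klrIdempotent k χ - klrIdempotent k χ))) := by
  have he := klrIdempotent_mem k χ
  have hY : MonoidAlgebra.of k _ (swap r' r'') * klrIdempotent k χ - klrIdempotent k χ ∈ jointEigenspace k χ :=
    sub_mem (of_swap_mul_mem_of_eq k h' hc' he) he
  have hZ : MonoidAlgebra.of k _ (swap r r') * (MonoidAlgebra.of k _ (swap r' r'') * klrIdempotent k χ -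
      klrIdempotent k χ) - (MonoidAlgebra.of k _ (swap r' r'') * klrIdempotent k χ - klrIdempotent k χ) ∈
      jointEigenspace k χ := sub_mem (of_swap_mul_mem_of_eq k h hc hY) hY
  have hM : ∀ (a b : Fin n) {w}, w ∈ jointEigenspace k χ → Ring.inverse (bkQ k a b χ) * w ∈ jointEigenspace k χ :=
    fun a b w hw => mul_mem_jointEigenspace_of_mem_yAlg k (ringInverse_bkQ_mem_yAlg k _ _ _) hw
  obtain ⟨-, P2, -, P4⟩ := of_swap_mul_moves k h h' hc hc'
  obtain ⟨-, -, -, S2'⟩ := bkCase5_scalars k hc hc'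
  have hsY : MonoidAlgebra.of k _ (swap r' r'') * (MonoidAlgebra.of k _ (swap r' r'') * klrIdempotent k χ -
      klrIdempotent k χ) = -(MonoidAlgebra.of k _ (swap r' r'') * klrIdempotent k χ - klrIdempotent k χ) := by
    rw [mul_sub, ← mul_assoc, of_swap_mul_self, one_mul, neg_sub]
  rw [bkPsi_psi12_of_eq_eq k h h' hc hc', mul_sub, bkPsi_mul_of_mem_eq k h' hc' (hM _ _ (hM _ _ hZ)),
    bkPsi_mul_of_mem_eq k h' hc' (hM _ _ (hM _ _ hY)), P2 _ hZ, P4 _ hY, hsY, ← sub_eq_zero]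
  rw [show Ring.inverse (bkQ k r'' r' χ) * (Ring.inverse (bkQ k r'' r χ) * (Ring.inverse (bkQ k r' r χ) *
      (MonoidAlgebra.of k _ (swap r' r'') * (MonoidAlgebra.of k _ (swap r r') *
        (MonoidAlgebra.of k _ (swap r' r'') * klrIdempotent k χ - klrIdempotent k χ) -
        (MonoidAlgebra.of k _ (swap r' r'') * klrIdempotent k χ - klrIdempotent k χ))))) -
      Ring.inverse (bkQ k r'' r' χ) * (Ring.inverse (bkQ k r' r χ) * (Ring.inverse (bkQ k r'' r χ) *
        (MonoidAlgebra.of k _ (swap r r') * (MonoidAlgebra.of k _ (swap r' r'') * klrIdempotent k χ -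
          klrIdempotent k χ) - (MonoidAlgebra.of k _ (swap r' r'') * klrIdempotent k χ - klrIdempotent k χ)))) -
      (Ring.inverse (bkQ k r'' r' χ) * (Ring.inverse (bkQ k r' r'' χ) * (Ring.inverse (bkQ k r' r χ) *
          -(MonoidAlgebra.of k _ (swap r' r'') * klrIdempotent k χ - klrIdempotent k χ)) +
        (Ring.inverse (bkQ k r' r'' χ) * Ring.inverse (bkQ k r' r χ) * Ring.inverse (bkQ k r'' r χ) +
          2 * (Ring.inverse (bkQ k r' r'' χ) * Ring.inverse (bkQ k r'' r' χ) * Ring.inverse (bkQ k r'' r χ))) *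
          (MonoidAlgebra.of k _ (swap r' r'') * klrIdempotent k χ - klrIdempotent k χ)) -
        Ring.inverse (bkQ k r'' r' χ) * (Ring.inverse (bkQ k r'' r' χ) * (Ring.inverse (bkQ k r'' r χ) *
          (MonoidAlgebra.of k _ (swap r' r'') * klrIdempotent k χ - klrIdempotent k χ)))) -
      (Ring.inverse (bkQ k r'' r' χ) * (Ring.inverse (bkQ k r'' r χ) * (Ring.inverse (bkQ k r' r χ) *
        (MonoidAlgebra.of k _ (swap r' r'') * (MonoidAlgebra.of k _ (swap r r') *
          (MonoidAlgebra.of k _ (swap r' r'') * klrIdempotent k χ - klrIdempotent k χ) -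
          (MonoidAlgebra.of k _ (swap r' r'') * klrIdempotent k χ - klrIdempotent k χ))))) -
      Ring.inverse (bkQ k r'' r' χ) * (Ring.inverse (bkQ k r' r χ) * (Ring.inverse (bkQ k r'' r χ) *
        (MonoidAlgebra.of k _ (swap r r') * (MonoidAlgebra.of k _ (swap r' r'') * klrIdempotent k χ -
          klrIdempotent k χ) - (MonoidAlgebra.of k _ (swap r' r'') * klrIdempotent k χ - klrIdempotent k χ)))) -
      Ring.inverse (bkQ k r'' r' χ) * (Ring.inverse (bkQ k r' r χ) * (Ring.inverse (bkQ k r'' r χ) *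
        (MonoidAlgebra.of k _ (swap r' r'') * klrIdempotent k χ - klrIdempotent k χ)))) =
      (Ring.inverse (bkQ k r'' r' χ) * Ring.inverse (bkQ k r' r'' χ) * Ring.inverse (bkQ k r' r χ) -
        Ring.inverse (bkQ k r'' r' χ) * (Ring.inverse (bkQ k r' r'' χ) * Ring.inverse (bkQ k r' r χ) *
          Ring.inverse (bkQ k r'' r χ)) -
        Ring.inverse (bkQ k r'' r' χ) * (2 * (Ring.inverse (bkQ k r' r'' χ) * Ring.inverse (bkQ k r'' r' χ) *
          Ring.inverse (bkQ k r'' r χ))) +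
        Ring.inverse (bkQ k r'' r' χ) * Ring.inverse (bkQ k r'' r' χ) * Ring.inverse (bkQ k r'' r χ) +
        Ring.inverse (bkQ k r'' r' χ) * Ring.inverse (bkQ k r' r χ) * Ring.inverse (bkQ k r'' r χ)) *
      (MonoidAlgebra.of k _ (swap r' r'') * klrIdempotent k χ - klrIdempotent k χ) by noncomm_ring,
    S2', zero_mul]

/-- **(R7) of Brundan–Kleshchev's Theorem 3.2, Case 5 (`i_r = i_{r+1} = i_{r+2}`, the nil-Hecke case
"left as an exercise" in arXiv:0808.2032): `ψ_rψ_{r+1}ψ_r e(𝐢) = ψ_{r+1}ψ_rψ_{r+1} e(𝐢)`.** Both sides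
equal `-(q̄_1 q̄_2 Ē)^{-1} Σ_{σ ∈ S_3} sgn(σ) σ e(𝐢)` (cited through [HuMathas2010, Thm 24]). [folklore] -/
theorem bkPsi_braid_of_eq_eq {r r' r'' : Fin n} (h : (r' : ℕ) = r + 1) (h' : (r'' : ℕ) = r' + 1)
    {χ : Fin n → k} (hc : χ r = χ r') (hc' : χ r' = χ r'') :
    bkPsi k r r' * bkPsi k r' r'' * bkPsi k r r' * klrIdempotent k χ =
      bkPsi k r' r'' * bkPsi k r r' * bkPsi k r' r'' * klrIdempotent k χ := by
  have hrr' : r ≠ r' := by intro e; rw [Fin.ext_iff] at e; omega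
  have hr'r'' : r' ≠ r'' := by intro e; rw [Fin.ext_iff] at e; omega
  have hrr'' : r ≠ r'' := by intro e; rw [Fin.ext_iff] at e; omega
  have cQ : ∀ x x' z z' : Fin n, Commute (Ring.inverse (bkQ k x x' χ)) (Ring.inverse (bkQ k z z' χ)) :=
    fun x x' z z' => (commute_bkQ k (fun t => (commute_bkQ k (commute_bkNilpotent k t) x x' χ).symm)
      z z' χ).ringInverse_ringInverse
  -- the braid relation in `k[S_n]`
  have hperm : swap r r' * swap r' r'' * swap r r' = swap r' r'' * swap r r' * swap r' r'' := by
    have A := swap_mul_swap_mul_swap (x := r'') (y := r') (z := r) (Ne.symm hr'r'') (Ne.symm hrr'')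
    have B := swap_mul_swap_mul_swap (x := r) (y := r') (z := r'') hrr' hrr''
    rw [swap_comm r' r, swap_comm r'' r'] at A
    rw [A, B, swap_comm]
  have hbr : MonoidAlgebra.of k _ (swap r r') * MonoidAlgebra.of k _ (swap r' r'') *
      MonoidAlgebra.of k _ (swap r r') = MonoidAlgebra.of k _ (swap r' r'') *
        MonoidAlgebra.of k _ (swap r r') * MonoidAlgebra.of k _ (swap r' r'') := by
    rw [← map_mul, ← map_mul, hperm, map_mul, map_mul]
  have hG : MonoidAlgebra.of k _ (swap r r') *
      (MonoidAlgebra.of k _ (swap r' r'') * (MonoidAlgebra.of k _ (swap r r') * klrIdempotent k χ -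
        klrIdempotent k χ) - (MonoidAlgebra.of k _ (swap r r') * klrIdempotent k χ - klrIdempotent k χ)) -
      (MonoidAlgebra.of k _ (swap r' r'') * (MonoidAlgebra.of k _ (swap r r') * klrIdempotent k χ -
        klrIdempotent k χ) - (MonoidAlgebra.of k _ (swap r r') * klrIdempotent k χ - klrIdempotent k χ)) -
      (MonoidAlgebra.of k _ (swap r r') * klrIdempotent k χ - klrIdempotent k χ) =
      MonoidAlgebra.of k _ (swap r' r'') *
      (MonoidAlgebra.of k _ (swap r r') * (MonoidAlgebra.of k _ (swap r' r'') * klrIdempotent k χ -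
        klrIdempotent k χ) - (MonoidAlgebra.of k _ (swap r' r'') * klrIdempotent k χ - klrIdempotent k χ)) -
      (MonoidAlgebra.of k _ (swap r r') * (MonoidAlgebra.of k _ (swap r' r'') * klrIdempotent k χ -
        klrIdempotent k χ) - (MonoidAlgebra.of k _ (swap r' r'') * klrIdempotent k χ - klrIdempotent k χ)) -
      (MonoidAlgebra.of k _ (swap r' r'') * klrIdempotent k χ - klrIdempotent k χ) := by
    rw [← sub_eq_zero]
    rw [show _ - _ = (MonoidAlgebra.of k _ (swap r r') * MonoidAlgebra.of k _ (swap r' r'') *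
        MonoidAlgebra.of k _ (swap r r') - MonoidAlgebra.of k _ (swap r' r'') *
        MonoidAlgebra.of k _ (swap r r') * MonoidAlgebra.of k _ (swap r' r'')) * klrIdempotent k χ -
        (MonoidAlgebra.of k _ (swap r r') * MonoidAlgebra.of k _ (swap r r') -
          MonoidAlgebra.of k _ (swap r' r'') * MonoidAlgebra.of k _ (swap r' r'')) * klrIdempotent k χ
        from by noncomm_ring, hbr, of_swap_mul_self, of_swap_mul_self, sub_self, sub_self, zero_mul, sub_zero]
  rw [mul_assoc, mul_assoc, bkPsi_triple_case5_lhs k h h' hc hc', mul_assoc, mul_assoc,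
    bkPsi_triple_case5_rhs k h h' hc hc']
  simp only [(cQ r'' r r'' r').left_comm, (cQ r'' r r' r).left_comm, (cQ r'' r' r' r).left_comm]
  simp only [← mul_sub]
  rw [hG]

/-- **(R7) of Brundan–Kleshchev's Theorem 3.2 in `k[S_n]`, all cases** (arXiv:0808.2032, Thm 3.2;
cited through [HuMathas2010, Thm 24]):
`ψ_rψ_{r+1}ψ_r e(𝐢) = ψ_{r+1}ψ_rψ_{r+1} e(𝐢) + δ_{i_r, i_{r+2}} c e(𝐢)` with `c = 1, -1, y_r - 2y_{r+1} + y_{r+2}, 0`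
according as `i_r → i_{r+1}`, `i_r ← i_{r+1}`, `i_r ⇄ i_{r+1}`, otherwise (so `c = 0` too when
`i_r = i_{r+1} = i_{r+2}`). [folklore] -/
theorem bkPsi_braid {r r' r'' : Fin n} (h : (r' : ℕ) = r + 1) (h' : (r'' : ℕ) = r' + 1)
    (χ : Fin n → k) :
    bkPsi k r r' * bkPsi k r' r'' * bkPsi k r r' * klrIdempotent k χ =
      bkPsi k r' r'' * bkPsi k r r' * bkPsi k r' r'' * klrIdempotent k χ +
        (if χ r = χ r'' ∧ χ r ≠ χ r' then
          (if χ r' = χ r + 1 then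
              (if χ r = χ r' + 1 then bkNilpotent k r - 2 * bkNilpotent k r' + bkNilpotent k r''
                else (1 : MonoidAlgebra k (Perm (Fin n))))
            else (if χ r = χ r' + 1 then (-1 : MonoidAlgebra k (Perm (Fin n))) else 0))
          else 0) * klrIdempotent k χ := by
  by_cases H : χ r = χ r'' ∧ χ r ≠ χ r'
  · rw [if_pos H]
    exact bkPsi_braid_of_eq_of_ne k h h' H.1 H.2
  · rw [if_neg H, zero_mul, add_zero]
    rw [not_and, not_not] at H
    by_cases h12 : χ r = χ r'
    · by_cases h23 : χ r' = χ r''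
      · exact bkPsi_braid_of_eq_eq k h h' h12 h23
      · exact bkPsi_braid_of_eq_ne k h h' h12 h23
    · have h13 : χ r ≠ χ r'' := fun e => h12 (H e)
      by_cases h23 : χ r' = χ r''
      · exact bkPsi_braid_of_ne_eq k h h' h12 h23
      · exact bkPsi_braid_of_ne k h h' h12 h23 h13

end BKCase5


end Literature.RepresentationTheory.FiniteGroups
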